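import Literature.Analysis.FluidPDE.LerayHopfCrossIdentityTorus
import Literature.Analysis.FluidPDE.NSUniqueness2HalfDEstimates
import Literature.Analysis.FluidPDE.NSHopfInvariant
import HarnessLib

/-!
# Weak–strong uniqueness for two-and-a-half-dimensional Leray–Hopf solutions on `T³`

Analysis/FluidPDE file (theorem-only) proving, on the flat torus `T³ = UnitAddTorus (Fin 3)` and
in the vocabulary of the accepted `Torus.IsLerayHopfOn`, the weak–strong uniqueness theorem of
Bardos–Lopes Filho–Niu–Nussenzveig Lopes–Titi, *Stability of two-dimensional viscous
incompressible flows under three-dimensional perturbations and inviscid symmetry breaking*,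
SIAM J. Math. Anal. 45 (2013), Thm. 3.1 and Remark 3.1 ("An immediate corollary of Theorem 3.1
is the uniqueness of Leray-Hopf weak solutions for two-dimensional initial data"), in the
uniqueness form used by Bardos–Titi–Wiedemann 2012, Thm. 5: a Leray–Hopf solution all of whose
slices are independent of `x₃` is unique among **all** Leray–Hopf solutions with its datum —
a weak–strong uniqueness statement *off* the Prodi–Serrin scale (the reference solution is only
in the energy class; the printed setting is `D × (0, L)` with `D ⊂ ℝ²` bounded, here `T³`).

## Results

* `Torus.IsLerayHopfOn.lintegral_enorm_sub_sq_add_le_of_invariant` — the difference energy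
  inequality: for Leray–Hopf solutions `u`, `U` of the unforced system with `ν ≥ 0`, `L²` data
  `u₀`, `U₀`, and `U` independent of `x₃`,
  `∫‖w(t)‖² + 2ν∫₀ᵗ‖∇w‖₂² ≤ ∫‖u₀ - U₀‖² + 18C ∫₀ᵗ ‖w‖₂(‖w‖₂² + ‖∇w‖₂²)^{1/2}‖∇U‖₂`, `w = u - U`
  (op. cit., proof of Thm. 3.1: Serrin's inequality "(27) in [Serrin62]" followed by the sliced
  Ladyzhenskaya bound; on the torus the inhomogeneous `H¹` norm appears and the constant is the
  tree's `Torus.anisotropicConst`, so the printed explicit constant `27/(64ν⁴)` is not claimed).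
* `Torus.IsLerayHopfOn.ae_eq_of_invariant` — weak–strong uniqueness for `ν > 0`: `u(t) = U(t)`
  a.e. for every `t ∈ (0,T]` when the data coincide (Young and the integral Grönwall lemma
  `FluidPDE.lintegral_gronwall_eq_zero` with the `L¹(0,T)` kernel `ν + 324C²ν⁻¹‖∇U‖₂²`).
* `Torus.lerayHopf_ae_eq_of_invariant_datum` — **uniqueness for `x₃`-independent data**
  (Remark 3.1): any two Leray–Hopf solutions with the same `x₃`-independent weakly
  divergence-free `L²` datum agree a.e. on every slice, the reference solution being supplied by
  Hopf's theorem in the invariant class (`hopf_existence_torus_invariant_holds`, proved in the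
  tree).

## Proof, as formalised

Fix `t ∈ (0,T]`. At truncation level `N` the cross identity
(`Torus.IsLerayHopfOn.integral_inner_fourierTruncate_eq_add_setIntegral`,
`LerayHopfCrossIdentityTorus`) reads `⟪P_N u(t),P_N U(t)⟫ = ⟪P_N u₀,P_N U₀⟫ + ∫₀ᵗ(X_N - 2ν D_N)`
with `X_N = ∫⟪u,(u·∇)P_N U⟫ + ∫⟪U,(U·∇)P_N u⟫` and the exact spectral Stokes cross term
`D_N = 4π²∑_{|k|≤N}|k|² Re⟪û,Û⟫` (`Torus.flux_zero_fourierTruncate_eq`); adding the two energy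
inequalities gives, for every `N`,
`‖u(t)‖² + ‖U(t)‖² - 2⟪P_Nu(t),P_NU(t)⟫ + 2ν(∫‖∇u‖² + ∫‖∇U‖² - 2∫D_N) ≤ ‖u₀‖² + ‖U₀‖² - 2⟪P_Nu₀,P_NU₀⟫ - 2∫X_N`.
As `N → ∞`: the truncated inner products converge (Parseval), `∫D_N → ∫D` by dominated
convergence and `∫‖∇w‖² = ∫‖∇u‖² + ∫‖∇U‖² - 2∫D`
(`Torus.IsLerayHopfOn.tendsto_setIntegral_crossSum`, `Torus.IsLerayHopfOn.toReal_lintegral_eGradNormSq_sub`);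
`X_N` equals the trilinear term `∫⟪w̃,(w̃·∇)P_N U⟫`, `w̃ = P_N u - P_N U`, on the smooth
divergence-free truncations (the cross convective identity) up to an error whose `L¹(0,t)` norm
tends to zero (`Torus.IsLerayHopfOn.tendsto_lintegral_cross_sub_trilinear`: the anisotropic
truncation-removal estimates of `NSUniqueness2HalfDEstimates`, dominated convergence in time),
and the trilinear term is bounded by the kernel (`Torus.enorm_integral_inner_convect_truncate_sub_le`).

## Mathlib search

Mathlib (this pin) has no Navier–Stokes theory (searched `Leray`, `weak-strong`, `Serrin`: tree
only); used: dominated convergence (`tendsto_integral_of_dominated_convergence`,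
`tendsto_lintegral_of_dominated_convergence'`), `integral_toReal`, limits of inequalities
(`le_of_tendsto_of_tendsto'`). Tree: the whole-space Prodi–Serrin weak–strong uniqueness
(`NSSerrinUniqueness`) is a different theorem (reference solution in `L^q_t L^p_x`); the
two-dimensional programme (`NSUniqueness2DParts`, `NSUniqueness2DTruncatedBalance`) shares the
Grönwall lemma and the slice lemmas reused here.

## References

* C. Bardos, M. C. Lopes Filho, D. Niu, H. J. Nussenzveig Lopes, E. S. Titi, SIAM J. Math.
  Anal. 45 (2013) 1871–1885 = arXiv:1201.2742, Thm. 3.1 (proof), Rem. 3.1. [BardosEtAl2013]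
* C. Bardos, E. S. Titi, E. Wiedemann, C. R. Math. Acad. Sci. Paris 350 (2012) 757–760, Thm. 5
  (proof). [BardosTitiWiedemann2012]
* J. Serrin, *The initial value problem for the Navier–Stokes equations*, in: Nonlinear Problems
  (Madison 1962), 1963, §4, Thm. 6, inequality (27). [Serrin1963]
* J. C. Robinson, J. L. Rodrigo, W. Sadowski, *The three-dimensional Navier–Stokes equations*,
  CUP 2016, Lemma A.25 (Grönwall). [RobinsonRodrigoSadowski2016]
-/

open MeasureTheory Set Filter Topology UnitAddTorus Function
open scoped ENNReal NNReal InnerProductSpace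

noncomputable section

namespace Literature.Analysis.FluidPDE

open FunctionSpaces

/-! ### Slice-level identities -/

/-- **The unforced tested pairing against a truncation** splits into the convective pairing and
the Stokes cross term:
`∫(⟪v,(v·∇)P_N w⟫ + ν⟪v, ΔP_N w⟫) = ∫⟪v,(v·∇)P_N w⟫ - ν · 4π² ∑_{|k|≤N} |k|² Re ⟪v̂, ŵ⟫`. [folklore] -/
theorem Torus.flux_zero_fourierTruncate_eq {d : Type*} [Fintype d] [DecidableEq d]
    (ν : ℝ) {v w : UnitAddTorus d → EuclideanSpace ℝ d} (hv : MemLp v 2 volume) (N : ℕ) :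
    ∫ x, (⟪v x, Torus.convect v (Torus.fourierTruncate N w) x⟫_ℝ +
        ν * ⟪v x, Torus.laplacian (Torus.fourierTruncate N w) x⟫_ℝ) =
      (∫ x, ⟪v x, Torus.convect v (Torus.fourierTruncate N w) x⟫_ℝ) -
        ν * (4 * Real.pi ^ 2 * ∑ k ∈ Torus.freqBall N, Torus.freqNormSq k *
          (inner ℂ (mFourierCoeff (EuclideanSpace.complexify ∘ v) k)
            (mFourierCoeff (EuclideanSpace.complexify ∘ w) k)).re) := by
  have hs : Torus.IsSmooth (Torus.fourierTruncate N w) := Torus.isSmooth_fourierTruncate _ _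
  have i1 := Torus.integrable_inner_convect_self hv hs
  have i2 : Integrable (fun x => ⟪v x, Torus.laplacian (Torus.fourierTruncate N w) x⟫_ℝ) volume :=
    Torus.integrable_inner_of_continuous (hv.integrable one_le_two) hs.laplacian.continuous
  rw [integral_add i1 (i2.const_mul ν), integral_const_mul,
    Torus.integral_inner_laplacian_fourierTruncate_cross (hv.integrable one_le_two)]
  ring

/-! ### Two Leray–Hopf solutions on `T³`: the limit `N → ∞` -/

section Limit

variable {T ν : ℝ} {u U : ℝ → UnitAddTorus (Fin 3) → EuclideanSpace ℝ (Fin 3)}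
  {u₀ U₀ : UnitAddTorus (Fin 3) → EuclideanSpace ℝ (Fin 3)}

/-- **The unforced energy inequality from `0`**, real form with `∫‖·‖²`:
`∫‖u(t)‖² + 2ν ∫₀ᵗ‖∇u‖₂² ≤ ∫‖u₀‖²`. [folklore] -/
theorem Torus.IsLerayHopfOn.integral_norm_sq_add_le_of_zero_force (hu : Torus.IsLerayHopfOn T ν 0 u₀ u)
    {t : ℝ} (ht : t ∈ Icc 0 T) :
    (∫ x, ‖u t x‖ ^ 2) + 2 * ν * (∫⁻ s in Ioo 0 t, Torus.eGradNormSq (u s)).toReal ≤ ∫ x, ‖u₀ x‖ ^ 2 := by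
  have h := hu.energy_ineq_zero t ht
  simp only [Pi.zero_apply, inner_zero_left, integral_zero, intervalIntegral.integral_zero, add_zero] at h
  unfold Torus.kineticEnergy at h
  linarith

/-- The squared `L²` distance of two slices in terms of the cross inner product:
`∫‖a - b‖² = ∫‖a‖² + ∫‖b‖² - 2∫⟪a, b⟫` for `a, b ∈ L²`. [folklore] -/
theorem Torus.integral_norm_sub_sq_eq {d : Type*} [Fintype d] {a b : UnitAddTorus d → EuclideanSpace ℝ d}
    (ha : MemLp a 2 volume) (hb : MemLp b 2 volume) :
    ∫ x, ‖a x - b x‖ ^ 2 = (∫ x, ‖a x‖ ^ 2) + (∫ x, ‖b x‖ ^ 2) - 2 * ∫ x, ⟪a x, b x⟫_ℝ := by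
  have i1 := ha.integrable_norm_pow two_ne_zero
  have i2 := hb.integrable_norm_pow two_ne_zero
  have i3 : Integrable (fun x => ⟪a x, b x⟫_ℝ) volume := integrable_inner_of_memLp_two ha hb
  have h : ∀ x, ‖a x - b x‖ ^ 2 = ‖a x‖ ^ 2 + ‖b x‖ ^ 2 - 2 * ⟪a x, b x⟫_ℝ := fun x => by
    rw [@norm_sub_sq ℝ]; simp only [RCLike.re_to_real]; ring
  simp_rw [h]
  have i12 : Integrable (fun x => ‖a x‖ ^ 2 + ‖b x‖ ^ 2) volume := i1.add i2
  have i32 : Integrable (fun x => 2 * ⟪a x, b x⟫_ℝ) volume := i3.const_mul 2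
  rw [integral_sub i12 i32, integral_add i1 i2, integral_const_mul]

/-- The slice Fourier coefficients of a Leray–Hopf solution are measurable in time on `(0, T)`. [folklore] -/
theorem Torus.IsLerayHopfOn.aestronglyMeasurable_mFourierCoeff {d : Type*} [Fintype d] [DecidableEq d]
    {T ν : ℝ} {f u : ℝ → UnitAddTorus d → EuclideanSpace ℝ d} {u₀ : UnitAddTorus d → EuclideanSpace ℝ d}
    (hu : Torus.IsLerayHopfOn T ν f u₀ u) (k : d → ℤ) :
    AEStronglyMeasurable (fun s => mFourierCoeff (EuclideanSpace.complexify ∘ u s) k) (volume.restrict (Ioo 0 T)) :=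
  Torus.aestronglyMeasurable_mFourierCoeff_complexify_slice hu.aestronglyMeasurable_uncurry k

/-- **The partial cross enstrophy sums of two Leray–Hopf solutions are measurable in time.** [folklore] -/
theorem Torus.IsLerayHopfOn.aestronglyMeasurable_crossSum (hu : Torus.IsLerayHopfOn T ν 0 u₀ u)
    (hU : Torus.IsLerayHopfOn T ν 0 U₀ U) (N : ℕ) :
    AEStronglyMeasurable (fun s => ∑ k ∈ Torus.freqBall N, Torus.freqNormSq k *
      (inner ℂ (mFourierCoeff (EuclideanSpace.complexify ∘ u s) k)
        (mFourierCoeff (EuclideanSpace.complexify ∘ U s) k)).re) (volume.restrict (Ioo 0 T)) := by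
  refine Finset.aestronglyMeasurable_fun_sum _ fun k _ => ?_
  have h1 := hu.aestronglyMeasurable_mFourierCoeff k
  have h2 := hU.aestronglyMeasurable_mFourierCoeff k
  have h3 : AEStronglyMeasurable (fun s => (inner ℂ (mFourierCoeff (EuclideanSpace.complexify ∘ u s) k)
      (mFourierCoeff (EuclideanSpace.complexify ∘ U s) k)).re) (volume.restrict (Ioo 0 T)) :=
    Complex.continuous_re.comp_aestronglyMeasurable (h1.inner h2)
  exact aestronglyMeasurable_const.mul h3

/-- **Dominated convergence of the partial cross enstrophy sums in time**: for two Leray–Hopf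
solutions on `T³ × [0,T)` and `t ≤ T`,
`∫₀ᵗ 4π²∑_{|k|≤N}|k|² Re⟪û,Û⟫ ds → ∫₀ᵗ 4π²∑'|k|² Re⟪û,Û⟫ ds` (bound `½(‖∇u‖₂² + ‖∇U‖₂²) ∈ L¹`),
with integrability of every term and of the limit. [folklore] -/
theorem Torus.IsLerayHopfOn.tendsto_setIntegral_crossSum (hu : Torus.IsLerayHopfOn T ν 0 u₀ u)
    (hU : Torus.IsLerayHopfOn T ν 0 U₀ U) {t : ℝ} (ht : t ≤ T) :
    (∀ N, IntegrableOn (fun s => 4 * Real.pi ^ 2 * ∑ k ∈ Torus.freqBall N, Torus.freqNormSq k *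
      (inner ℂ (mFourierCoeff (EuclideanSpace.complexify ∘ u s) k)
        (mFourierCoeff (EuclideanSpace.complexify ∘ U s) k)).re) (Ioo 0 t)) ∧
    IntegrableOn (fun s => 4 * Real.pi ^ 2 * ∑' k : Fin 3 → ℤ, Torus.freqNormSq k *
      (inner ℂ (mFourierCoeff (EuclideanSpace.complexify ∘ u s) k)
        (mFourierCoeff (EuclideanSpace.complexify ∘ U s) k)).re) (Ioo 0 t) ∧
    Tendsto (fun N => ∫ s in Ioo 0 t, 4 * Real.pi ^ 2 * ∑ k ∈ Torus.freqBall N, Torus.freqNormSq k *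
      (inner ℂ (mFourierCoeff (EuclideanSpace.complexify ∘ u s) k)
        (mFourierCoeff (EuclideanSpace.complexify ∘ U s) k)).re) atTop
      (𝓝 (∫ s in Ioo 0 t, 4 * Real.pi ^ 2 * ∑' k : Fin 3 → ℤ, Torus.freqNormSq k *
        (inner ℂ (mFourierCoeff (EuclideanSpace.complexify ∘ u s) k)
          (mFourierCoeff (EuclideanSpace.complexify ∘ U s) k)).re)) := by
  set μ : Measure ℝ := volume.restrict (Ioo 0 t) with hμ
  have hsub : Ioo 0 t ⊆ Ioo 0 T := Ioo_subset_Ioo le_rfl ht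
  have hle : μ ≤ volume.restrict (Ioo 0 T) := Measure.restrict_mono hsub le_rfl
  set F : ℕ → ℝ → ℝ := fun N s => 4 * Real.pi ^ 2 * ∑ k ∈ Torus.freqBall N, Torus.freqNormSq k *
    (inner ℂ (mFourierCoeff (EuclideanSpace.complexify ∘ u s) k)
      (mFourierCoeff (EuclideanSpace.complexify ∘ U s) k)).re with hF
  set Fl : ℝ → ℝ := fun s => 4 * Real.pi ^ 2 * ∑' k : Fin 3 → ℤ, Torus.freqNormSq k *
    (inner ℂ (mFourierCoeff (EuclideanSpace.complexify ∘ u s) k)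
      (mFourierCoeff (EuclideanSpace.complexify ∘ U s) k)).re with hFl
  set bound : ℝ → ℝ := fun s => 2⁻¹ * ((Torus.eGradNormSq (u s)).toReal + (Torus.eGradNormSq (U s)).toReal) with hbound
  -- measurability
  have hFm : ∀ N, AEStronglyMeasurable (F N) μ := fun N =>
    (aestronglyMeasurable_const.mul (hu.aestronglyMeasurable_crossSum hU N)).mono_measure hle
  -- finiteness of the enstrophies for a.e. time
  have hfin : ∀ᵐ s ∂μ, Torus.eGradNormSq (u s) < ⊤ ∧ Torus.eGradNormSq (U s) < ⊤ := by
    have h1 : ∀ᵐ s ∂(volume.restrict (Ioo 0 T)), Torus.eGradNormSq (u s) < ⊤ :=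
      ae_lt_top' hu.aemeasurable_eGradNormSq hu.lintegral_eGradNormSq_lt_top.ne
    have h2 : ∀ᵐ s ∂(volume.restrict (Ioo 0 T)), Torus.eGradNormSq (U s) < ⊤ :=
      ae_lt_top' hU.aemeasurable_eGradNormSq hU.lintegral_eGradNormSq_lt_top.ne
    exact ae_mono hle (h1.and h2)
  -- the bound is integrable
  have hbi : Integrable bound μ := by
    have i1 : Integrable (fun s => (Torus.eGradNormSq (u s)).toReal) μ :=
      (integrable_toReal_of_lintegral_ne_top hu.aemeasurable_eGradNormSq hu.lintegral_eGradNormSq_lt_top.ne).mono_measure hle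
    have i2 : Integrable (fun s => (Torus.eGradNormSq (U s)).toReal) μ :=
      (integrable_toReal_of_lintegral_ne_top hU.aemeasurable_eGradNormSq hU.lintegral_eGradNormSq_lt_top.ne).mono_measure hle
    exact (i1.add i2).const_mul _
  -- domination and pointwise convergence
  have hdom : ∀ N, ∀ᵐ s ∂μ, ‖F N s‖ ≤ bound s := fun N => hfin.mono fun s hs => by
    rw [Real.norm_eq_abs, hF]
    dsimp only
    rw [abs_mul, abs_of_nonneg (by positivity : (0 : ℝ) ≤ 4 * Real.pi ^ 2)]
    exact Torus.abs_sum_freqNormSq_mul_re_inner_le hs.1.ne hs.2.ne N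
  have hlim : ∀ᵐ s ∂μ, Tendsto (fun N => F N s) atTop (𝓝 (Fl s)) := hfin.mono fun s hs =>
    (Torus.tendsto_sum_freqNormSq_mul_re_inner hs.1.ne hs.2.ne).const_mul _
  have hint : ∀ N, Integrable (F N) μ := fun N => hbi.mono' (hFm N) (hdom N)
  have hFlm : AEStronglyMeasurable Fl μ := aestronglyMeasurable_of_tendsto_ae atTop hFm hlim
  have hFli : Integrable Fl μ :=
    hbi.mono' hFlm (by
      filter_upwards [hlim, ae_all_iff.2 hdom] with s hs hs'
      exact le_of_tendsto ((continuous_norm.tendsto _).comp hs) (Eventually.of_forall hs'))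
  exact ⟨hint, hFli, tendsto_integral_of_dominated_convergence bound hFm hbi hdom hlim⟩

/-- **The dissipation of the difference in terms of the cross enstrophy in time**: for two
Leray–Hopf solutions on `T³ × [0,T)` and `t ≤ T`, `∫₀ᵗ ‖∇(u - U)‖₂²` is finite and
`∫₀ᵗ‖∇(u - U)‖₂² = ∫₀ᵗ‖∇u‖₂² + ∫₀ᵗ‖∇U‖₂² - 2∫₀ᵗ 4π²∑'|k|² Re⟪û,Û⟫`. [folklore] -/
theorem Torus.IsLerayHopfOn.toReal_lintegral_eGradNormSq_sub (hu : Torus.IsLerayHopfOn T ν 0 u₀ u)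
    (hU : Torus.IsLerayHopfOn T ν 0 U₀ U) {t : ℝ} (ht : t ≤ T) :
    (∫⁻ s in Ioo 0 t, Torus.eGradNormSq (u s - U s)) ≠ ⊤ ∧
    (∫⁻ s in Ioo 0 t, Torus.eGradNormSq (u s - U s)).toReal =
      (∫⁻ s in Ioo 0 t, Torus.eGradNormSq (u s)).toReal + (∫⁻ s in Ioo 0 t, Torus.eGradNormSq (U s)).toReal -
        2 * ∫ s in Ioo 0 t, 4 * Real.pi ^ 2 * ∑' k : Fin 3 → ℤ, Torus.freqNormSq k *
          (inner ℂ (mFourierCoeff (EuclideanSpace.complexify ∘ u s) k)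
            (mFourierCoeff (EuclideanSpace.complexify ∘ U s) k)).re := by
  set μ : Measure ℝ := volume.restrict (Ioo 0 t) with hμ
  have hsub : Ioo 0 t ⊆ Ioo 0 T := Ioo_subset_Ioo le_rfl ht
  have hle : μ ≤ volume.restrict (Ioo 0 T) := Measure.restrict_mono hsub le_rfl
  have hmu : AEMeasurable (fun s => Torus.eGradNormSq (u s)) μ := hu.aemeasurable_eGradNormSq.mono_measure hle
  have hmU : AEMeasurable (fun s => Torus.eGradNormSq (U s)) μ := hU.aemeasurable_eGradNormSq.mono_measure hle
  have hlu : ∫⁻ s, Torus.eGradNormSq (u s) ∂μ ≠ ⊤ :=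
    ((lintegral_mono' hle le_rfl).trans_lt hu.lintegral_eGradNormSq_lt_top).ne
  have hlU : ∫⁻ s, Torus.eGradNormSq (U s) ∂μ ≠ ⊤ :=
    ((lintegral_mono' hle le_rfl).trans_lt hU.lintegral_eGradNormSq_lt_top).ne
  have hfin : ∀ᵐ s ∂μ, Torus.eGradNormSq (u s) < ⊤ ∧ Torus.eGradNormSq (U s) < ⊤ :=
    (ae_lt_top' hmu hlu).and (ae_lt_top' hmU hlU)
  -- the difference: pointwise bound and measurability through the identity
  have hslice : ∀ s ∈ Ioo 0 t, Integrable (u s) volume ∧ Integrable (U s) volume := fun s hs =>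
    ⟨(hu.memLp s (Ioo_subset_Icc_self (hsub hs))).integrable one_le_two,
      (hU.memLp s (Ioo_subset_Icc_self (hsub hs))).integrable one_le_two⟩
  have hwle : ∀ᵐ s ∂μ, Torus.eGradNormSq (u s - U s) ≤ 2 * Torus.eGradNormSq (u s) + 2 * Torus.eGradNormSq (U s) :=
    (ae_restrict_mem measurableSet_Ioo).mono fun s hs => Torus.eGradNormSq_sub_le (hslice s hs).1 (hslice s hs).2
  have hlw : ∫⁻ s, Torus.eGradNormSq (u s - U s) ∂μ ≠ ⊤ := by
    refine ne_top_of_le_ne_top ?_ (lintegral_mono_ae hwle)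
    rw [lintegral_add_left' (hmu.const_mul _), lintegral_const_mul'' _ hmu, lintegral_const_mul'' _ hmU]
    exact ENNReal.add_ne_top.2 ⟨ENNReal.mul_ne_top ENNReal.ofNat_ne_top hlu, ENNReal.mul_ne_top ENNReal.ofNat_ne_top hlU⟩
  obtain ⟨-, hDi, -⟩ := hu.tendsto_setIntegral_crossSum hU ht
  -- the real identity for a.e. time
  have hid : ∀ᵐ s ∂μ, (Torus.eGradNormSq (u s - U s)).toReal =
      (Torus.eGradNormSq (u s)).toReal + (Torus.eGradNormSq (U s)).toReal -
        2 * (4 * Real.pi ^ 2 * ∑' k : Fin 3 → ℤ, Torus.freqNormSq k *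
          (inner ℂ (mFourierCoeff (EuclideanSpace.complexify ∘ u s) k)
            (mFourierCoeff (EuclideanSpace.complexify ∘ U s) k)).re) := by
    filter_upwards [hfin, ae_restrict_mem measurableSet_Ioo] with s hs hsI
    have h := Torus.toReal_eGradNormSq_sub_eq (hslice s hsI).1 (hslice s hsI).2 hs.1.ne hs.2.ne
    exact h
  -- measurability of the difference dissipation through the identity
  have hwm : AEMeasurable (fun s => Torus.eGradNormSq (u s - U s)) μ := by
    have hreal : AEStronglyMeasurable (fun s => (Torus.eGradNormSq (u s - U s)).toReal) μ := by
      refine (((hmu.ennreal_toReal.aestronglyMeasurable).add hmU.ennreal_toReal.aestronglyMeasurable).sub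
        (hDi.aestronglyMeasurable.const_mul 2)).congr ?_
      exact hid.mono fun s hs => hs.symm
    have hwfin : ∀ᵐ s ∂μ, Torus.eGradNormSq (u s - U s) < ⊤ := by
      filter_upwards [hwle, hfin] with s hs hs'
      exact hs.trans_lt (ENNReal.add_lt_top.2 ⟨ENNReal.mul_lt_top ENNReal.ofNat_lt_top hs'.1,
        ENNReal.mul_lt_top ENNReal.ofNat_lt_top hs'.2⟩)
    have h := hreal.aemeasurable.ennreal_ofReal
    refine h.congr ?_
    filter_upwards [hwfin] with s hs
    exact ENNReal.ofReal_toReal hs.ne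
  refine ⟨hlw, ?_⟩
  have hwfin : ∀ᵐ s ∂μ, Torus.eGradNormSq (u s - U s) < ⊤ := ae_lt_top' hwm hlw
  rw [← integral_toReal hwm hwfin, ← integral_toReal hmu (hfin.mono fun s hs => hs.1),
    ← integral_toReal hmU (hfin.mono fun s hs => hs.2), integral_congr_ae hid]
  have i1 : Integrable (fun s => (Torus.eGradNormSq (u s)).toReal) μ := integrable_toReal_of_lintegral_ne_top hmu hlu
  have i2 : Integrable (fun s => (Torus.eGradNormSq (U s)).toReal) μ := integrable_toReal_of_lintegral_ne_top hmU hlU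
  have i12 : Integrable (fun s => (Torus.eGradNormSq (u s)).toReal + (Torus.eGradNormSq (U s)).toReal) μ := i1.add i2
  have iD2 : Integrable (fun s => 2 * (4 * Real.pi ^ 2 * ∑' k : Fin 3 → ℤ, Torus.freqNormSq k *
      (inner ℂ (mFourierCoeff (EuclideanSpace.complexify ∘ u s) k)
        (mFourierCoeff (EuclideanSpace.complexify ∘ U s) k)).re)) μ := hDi.const_mul 2
  rw [integral_sub i12 iD2, integral_add i1 i2, integral_const_mul]

/-- **The convective cross terms versus the trilinear term on the truncations, one slice.** For
`v, V ∈ L²(T³; ℝ³)` weakly divergence free with `V` independent of `x₃`, `ṽ = P_N v`, `Ṽ = P_N V`,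
`w̃ = ṽ - Ṽ`:
`|∫⟪v,(v·∇)Ṽ⟫ + ∫⟪V,(V·∇)ṽ⟫ - ∫⟪w̃,(w̃·∇)Ṽ⟫|
   ≤ 18C [‖v‖₂^{1/2}(‖v‖₂²+‖∇v‖₂²)^{1/2}‖P_N v - v‖₂^{1/2}‖∇V‖₂ + ‖V‖₂^{1/2}(‖V‖₂²+‖∇V‖₂²)^{1/2}‖P_N V - V‖₂^{1/2}‖∇v‖₂]`
(the cross convective identity on the smooth divergence-free truncations,
`Torus.integral_inner_convect_add_integral_inner_convect_eq`, and the two truncation-removal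
estimates `Torus.enorm_integral_inner_convect_sub_truncate_le(')`). [cite: BardosEtAl2013, Thm. 3.1 (proof)] -/
theorem Torus.enorm_cross_sub_trilinear_truncate_le {v V : UnitAddTorus (Fin 3) → EuclideanSpace ℝ (Fin 3)}
    (hv : MemLp v 2 volume) (hV : MemLp V 2 volume) (hdivv : Torus.IsWeaklyDivFree v)
    (hdivV : Torus.IsWeaklyDivFree V)
    (hVinv : ∀ (s : UnitAddCircle) (x : UnitAddTorus (Fin 3)), V (x + Pi.single (2 : Fin 3) s) = V x) (N : ℕ) :
    ‖((∫ x, ⟪v x, Torus.convect v (Torus.fourierTruncate N V) x⟫_ℝ) +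
        ∫ x, ⟪V x, Torus.convect V (Torus.fourierTruncate N v) x⟫_ℝ) -
        ∫ x, ⟪Torus.fourierTruncate N v x - Torus.fourierTruncate N V x,
          Torus.convect (fun y => Torus.fourierTruncate N v y - Torus.fourierTruncate N V y)
            (Torus.fourierTruncate N V) x⟫_ℝ‖ₑ ≤
      18 * Torus.anisotropicConst * (∫⁻ x, ‖v x‖ₑ ^ 2) ^ (1 / 4 : ℝ) *
          ((∫⁻ x, ‖v x‖ₑ ^ 2) + Torus.eGradNormSq v) ^ (1 / 2 : ℝ) *
          (∫⁻ x, ‖Torus.fourierTruncate N v x - v x‖ₑ ^ 2) ^ (1 / 4 : ℝ) * Torus.eGradNormSq V ^ (1 / 2 : ℝ) +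
        18 * Torus.anisotropicConst * (∫⁻ x, ‖V x‖ₑ ^ 2) ^ (1 / 4 : ℝ) *
          ((∫⁻ x, ‖V x‖ₑ ^ 2) + Torus.eGradNormSq V) ^ (1 / 2 : ℝ) *
          (∫⁻ x, ‖Torus.fourierTruncate N V x - V x‖ₑ ^ 2) ^ (1 / 4 : ℝ) * Torus.eGradNormSq v ^ (1 / 2 : ℝ) := by
  set a := Torus.fourierTruncate N v with ha
  set c := Torus.fourierTruncate N V with hc
  have has : Torus.IsSmooth a := Torus.isSmooth_fourierTruncate _ _
  have hcs : Torus.IsSmooth c := Torus.isSmooth_fourierTruncate _ _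
  have hadiv : Torus.IsDivFree a := Torus.isDivFree_fourierTruncate hv hdivv N
  have hcdiv : Torus.IsDivFree c := Torus.isDivFree_fourierTruncate hV hdivV N
  have hcinv : ∀ (s : UnitAddCircle) (x : UnitAddTorus (Fin 3)), c (x + Pi.single (2 : Fin 3) s) = c x :=
    Torus.fourierTruncate_add_single hVinv N
  -- the trilinear term is the sum of the two smooth cross terms
  have halg := Torus.integral_inner_convect_add_integral_inner_convect_eq has hcs hadiv hcdiv
  rw [← halg]
  have hsplit : ((∫ x, ⟪v x, Torus.convect v c x⟫_ℝ) + ∫ x, ⟪V x, Torus.convect V a x⟫_ℝ) -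
      ((∫ x, ⟪a x, Torus.convect a c x⟫_ℝ) + ∫ x, ⟪c x, Torus.convect c a x⟫_ℝ) =
      ((∫ x, ⟪v x, Torus.convect v c x⟫_ℝ) - ∫ x, ⟪a x, Torus.convect a c x⟫_ℝ) +
        ((∫ x, ⟪V x, Torus.convect V a x⟫_ℝ) - ∫ x, ⟪c x, Torus.convect c a x⟫_ℝ) := by ring
  rw [hsplit]
  refine (enorm_add_le _ _).trans (add_le_add ?_ ?_)
  · have h := Torus.enorm_integral_inner_convect_sub_truncate_le hv hcs hcinv N
    refine h.trans ?_
    have hG : ∑ i, ∫⁻ x, ‖Torus.partialDeriv i c x‖ₑ ^ 2 ≤ Torus.eGradNormSq V := by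
      rw [Torus.sum_lintegral_enorm_sq_partialDeriv_eq_eGradNormSq hcs]
      exact eGradNormSq_fourierTruncate_le (hV.integrable one_le_two) N
    exact mul_le_mul' le_rfl (ENNReal.rpow_le_rpow hG (by norm_num))
  · have h := Torus.enorm_integral_inner_convect_sub_truncate_le' hV hVinv has N
    refine h.trans ?_
    have hG : ∑ i, ∫⁻ x, ‖Torus.partialDeriv i a x‖ₑ ^ 2 ≤ Torus.eGradNormSq v := by
      rw [Torus.sum_lintegral_enorm_sq_partialDeriv_eq_eGradNormSq has]
      exact eGradNormSq_fourierTruncate_le (hv.integrable one_le_two) N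
    exact mul_le_mul' le_rfl (ENNReal.rpow_le_rpow hG (by norm_num))

/-- `x^{1/4} x^{1/4} = x^{1/2}` in `ℝ≥0∞`. [folklore] -/
theorem _root_.ENNReal.rpow_quarter_mul_rpow_quarter (x : ℝ≥0∞) :
    x ^ (1 / 4 : ℝ) * x ^ (1 / 4 : ℝ) = x ^ (1 / 2 : ℝ) := by
  rw [← ENNReal.rpow_add_of_nonneg _ _ (by norm_num) (by norm_num)]; norm_num

/-- **The convective error of the truncated cross identity vanishes in `L¹(0,t)` as `N → ∞`.**
For Leray–Hopf solutions `u, U` of the unforced system on `T³ × [0,T)` with `U` independent of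
`x₃`, and `t ≤ T`: the slice error of `Torus.enorm_cross_sub_trilinear_truncate_le` has finite
time integral for every `N` and its time integral tends to `0` (dominated convergence: the bound
of the previous lemma is at most `18C ‖u‖₂‖u‖_{H¹}‖∇U‖₂ + 18C ‖U‖₂‖U‖_{H¹}‖∇u‖₂ ∈ L¹(0,T)` and
tends to zero for a.e. `s` since `P_N u(s) → u(s)`, `P_N U(s) → U(s)` in `L²`). [cite: BardosEtAl2013, Thm. 3.1 (proof)] -/
theorem Torus.IsLerayHopfOn.tendsto_lintegral_cross_sub_trilinear (hu : Torus.IsLerayHopfOn T ν 0 u₀ u)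
    (hU : Torus.IsLerayHopfOn T ν 0 U₀ U) (hν : 0 ≤ ν)
    (hUinv : ∀ (t : ℝ) (s : UnitAddCircle) (x : UnitAddTorus (Fin 3)), U t (x + Pi.single (2 : Fin 3) s) = U t x)
    {t : ℝ} (ht : t ≤ T) :
    (∀ N, AEMeasurable (fun s => ‖((∫ x, ⟪u s x, Torus.convect (u s) (Torus.fourierTruncate N (U s)) x⟫_ℝ) +
        ∫ x, ⟪U s x, Torus.convect (U s) (Torus.fourierTruncate N (u s)) x⟫_ℝ) -
        ∫ x, ⟪Torus.fourierTruncate N (u s) x - Torus.fourierTruncate N (U s) x,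
          Torus.convect (fun y => Torus.fourierTruncate N (u s) y - Torus.fourierTruncate N (U s) y)
            (Torus.fourierTruncate N (U s)) x⟫_ℝ‖ₑ) (volume.restrict (Ioo 0 t))) ∧
    (∀ N, ∫⁻ s in Ioo 0 t, ‖((∫ x, ⟪u s x, Torus.convect (u s) (Torus.fourierTruncate N (U s)) x⟫_ℝ) +
        ∫ x, ⟪U s x, Torus.convect (U s) (Torus.fourierTruncate N (u s)) x⟫_ℝ) -
        ∫ x, ⟪Torus.fourierTruncate N (u s) x - Torus.fourierTruncate N (U s) x,
          Torus.convect (fun y => Torus.fourierTruncate N (u s) y - Torus.fourierTruncate N (U s) y)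
            (Torus.fourierTruncate N (U s)) x⟫_ℝ‖ₑ ≠ ⊤) ∧
    Tendsto (fun N => ∫⁻ s in Ioo 0 t, ‖((∫ x, ⟪u s x, Torus.convect (u s) (Torus.fourierTruncate N (U s)) x⟫_ℝ) +
        ∫ x, ⟪U s x, Torus.convect (U s) (Torus.fourierTruncate N (u s)) x⟫_ℝ) -
        ∫ x, ⟪Torus.fourierTruncate N (u s) x - Torus.fourierTruncate N (U s) x,
          Torus.convect (fun y => Torus.fourierTruncate N (u s) y - Torus.fourierTruncate N (U s) y)
            (Torus.fourierTruncate N (U s)) x⟫_ℝ‖ₑ) atTop (𝓝 0) := by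
  set μ : Measure ℝ := volume.restrict (Ioo 0 t) with hμ
  have hsub : Ioo 0 t ⊆ Ioo 0 T := Ioo_subset_Ioo le_rfl ht
  have hle : μ ≤ volume.restrict (Ioo 0 T) := Measure.restrict_mono hsub le_rfl
  set C : ℝ≥0∞ := Torus.anisotropicConst with hC
  have hCtop : C ≠ ⊤ := Torus.anisotropicConst_ne_top
  -- `x^{1/2} y^{1/2} ≤ x + y` (the tree's `ennreal_rpow_half_mul_rpow_half_le` of `NSVelocityUniqueness`,
  -- inlined to keep the import closure small)
  have hAMGM : ∀ x y : ℝ≥0∞, x ^ (1 / 2 : ℝ) * y ^ (1 / 2 : ℝ) ≤ x + y := by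
    intro x y
    have hx : x ^ (1 / 2 : ℝ) ≤ (max x y) ^ (1 / 2 : ℝ) := ENNReal.rpow_le_rpow (le_max_left _ _) (by norm_num)
    have hy : y ^ (1 / 2 : ℝ) ≤ (max x y) ^ (1 / 2 : ℝ) := ENNReal.rpow_le_rpow (le_max_right _ _) (by norm_num)
    calc x ^ (1 / 2 : ℝ) * y ^ (1 / 2 : ℝ) ≤ (max x y) ^ (1 / 2 : ℝ) * (max x y) ^ (1 / 2 : ℝ) := mul_le_mul' hx hy
      _ = max x y := by
          rw [← ENNReal.rpow_add_of_nonneg _ _ (by norm_num) (by norm_num)]; norm_num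
      _ ≤ x + y := max_le le_self_add le_add_self
  -- ### notation for the slice quantities
  set Au : ℝ → ℝ≥0∞ := fun s => ∫⁻ x, ‖u s x‖ₑ ^ 2 with hAu
  set AU : ℝ → ℝ≥0∞ := fun s => ∫⁻ x, ‖U s x‖ₑ ^ 2 with hAU
  set Gu : ℝ → ℝ≥0∞ := fun s => Torus.eGradNormSq (u s) with hGu
  set GU : ℝ → ℝ≥0∞ := fun s => Torus.eGradNormSq (U s) with hGU
  set δu : ℕ → ℝ → ℝ≥0∞ := fun N s => ∫⁻ x, ‖Torus.fourierTruncate N (u s) x - u s x‖ₑ ^ 2 with hδu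
  set δU : ℕ → ℝ → ℝ≥0∞ := fun N s => ∫⁻ x, ‖Torus.fourierTruncate N (U s) x - U s x‖ₑ ^ 2 with hδU
  set F : ℕ → ℝ → ℝ≥0∞ := fun N s => ‖((∫ x, ⟪u s x, Torus.convect (u s) (Torus.fourierTruncate N (U s)) x⟫_ℝ) +
        ∫ x, ⟪U s x, Torus.convect (U s) (Torus.fourierTruncate N (u s)) x⟫_ℝ) -
        ∫ x, ⟪Torus.fourierTruncate N (u s) x - Torus.fourierTruncate N (U s) x,
          Torus.convect (fun y => Torus.fourierTruncate N (u s) y - Torus.fourierTruncate N (U s) y)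
            (Torus.fourierTruncate N (U s)) x⟫_ℝ‖ₑ with hF
  set E : ℕ → ℝ → ℝ≥0∞ := fun N s =>
    18 * C * Au s ^ (1 / 4 : ℝ) * (Au s + Gu s) ^ (1 / 2 : ℝ) * δu N s ^ (1 / 4 : ℝ) * GU s ^ (1 / 2 : ℝ) +
      18 * C * AU s ^ (1 / 4 : ℝ) * (AU s + GU s) ^ (1 / 2 : ℝ) * δU N s ^ (1 / 4 : ℝ) * Gu s ^ (1 / 2 : ℝ) with hE
  -- ### uniform `L²` bounds and the dominating function
  have hf0m : AEStronglyMeasurable (Torus.stLift (0 : ℝ → UnitAddTorus (Fin 3) → EuclideanSpace ℝ (Fin 3)))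
      (volume.restrict (Ioo 0 T ×ˢ univ)) := aestronglyMeasurable_const (b := (0 : EuclideanSpace ℝ (Fin 3)))
  have hf0 : ∫⁻ _ in Ioo 0 T, ∫⁻ _ : UnitAddTorus (Fin 3), ‖(0 : EuclideanSpace ℝ (Fin 3))‖ₑ ^ 2 < ⊤ := by simp
  obtain ⟨Mu, hMu, hMu'⟩ := hu.exists_forall_lintegral_enorm_sq_le hν hf0m hf0
  obtain ⟨MU, hMU, hMU'⟩ := hU.exists_forall_lintegral_enorm_sq_le hν hf0m hf0
  set bound : ℝ → ℝ≥0∞ := fun s => 18 * C * Mu ^ (1 / 2 : ℝ) * (Au s + Gu s + GU s) +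
    18 * C * MU ^ (1 / 2 : ℝ) * (AU s + GU s + Gu s) with hbound
  have hmu : AEMeasurable Gu μ := hu.aemeasurable_eGradNormSq.mono_measure hle
  have hmU : AEMeasurable GU μ := hU.aemeasurable_eGradNormSq.mono_measure hle
  have hmAu : AEMeasurable Au μ := (hu.aemeasurable_lintegral_enorm_pow 2).mono_measure hle
  have hmAU : AEMeasurable AU μ := (hU.aemeasurable_lintegral_enorm_pow 2).mono_measure hle
  have hlu : ∫⁻ s, Gu s ∂μ ≠ ⊤ := ((lintegral_mono' hle le_rfl).trans_lt hu.lintegral_eGradNormSq_lt_top).ne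
  have hlU : ∫⁻ s, GU s ∂μ ≠ ⊤ := ((lintegral_mono' hle le_rfl).trans_lt hU.lintegral_eGradNormSq_lt_top).ne
  haveI : IsFiniteMeasure μ := ⟨by rw [hμ, Measure.restrict_apply_univ]; exact measure_Ioo_lt_top⟩
  have hAule : ∀ᵐ s ∂μ, Au s ≤ Mu := (ae_restrict_mem measurableSet_Ioo).mono fun s hs =>
    hMu' s (Ioo_subset_Icc_self (hsub hs))
  have hAUle : ∀ᵐ s ∂μ, AU s ≤ MU := (ae_restrict_mem measurableSet_Ioo).mono fun s hs =>
    hMU' s (Ioo_subset_Icc_self (hsub hs))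
  have hlAu : ∫⁻ s, Au s ∂μ ≠ ⊤ := by
    refine ne_top_of_le_ne_top ?_ (lintegral_mono_ae hAule)
    rw [lintegral_const]; exact ENNReal.mul_ne_top hMu (measure_ne_top _ _)
  have hlAU : ∫⁻ s, AU s ∂μ ≠ ⊤ := by
    refine ne_top_of_le_ne_top ?_ (lintegral_mono_ae hAUle)
    rw [lintegral_const]; exact ENNReal.mul_ne_top hMU (measure_ne_top _ _)
  have hbound_fin : ∫⁻ s, bound s ∂μ ≠ ⊤ := by
    have h1 : ∫⁻ s, (Au s + Gu s + GU s) ∂μ ≠ ⊤ := by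
      rw [lintegral_add_right' _ hmU, lintegral_add_right' _ hmu]
      exact ENNReal.add_ne_top.2 ⟨ENNReal.add_ne_top.2 ⟨hlAu, hlu⟩, hlU⟩
    have h2 : ∫⁻ s, (AU s + GU s + Gu s) ∂μ ≠ ⊤ := by
      rw [lintegral_add_right' _ hmu, lintegral_add_right' _ hmU]
      exact ENNReal.add_ne_top.2 ⟨ENNReal.add_ne_top.2 ⟨hlAU, hlU⟩, hlu⟩
    have hc1 : 18 * C * Mu ^ (1 / 2 : ℝ) ≠ ⊤ := ENNReal.mul_ne_top (ENNReal.mul_ne_top ENNReal.ofNat_ne_top hCtop)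
      (ENNReal.rpow_ne_top_of_nonneg (by norm_num) hMu)
    have hc2 : 18 * C * MU ^ (1 / 2 : ℝ) ≠ ⊤ := ENNReal.mul_ne_top (ENNReal.mul_ne_top ENNReal.ofNat_ne_top hCtop)
      (ENNReal.rpow_ne_top_of_nonneg (by norm_num) hMU)
    have m1 : AEMeasurable (fun s => Au s + Gu s + GU s) μ := (hmAu.add hmu).add hmU
    have m2 : AEMeasurable (fun s => AU s + GU s + Gu s) μ := (hmAU.add hmU).add hmu
    have m1' : AEMeasurable (fun s => 18 * C * Mu ^ (1 / 2 : ℝ) * (Au s + Gu s + GU s)) μ := m1.const_mul _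
    have hsplit : ∫⁻ s, bound s ∂μ = 18 * C * Mu ^ (1 / 2 : ℝ) * ∫⁻ s, (Au s + Gu s + GU s) ∂μ +
        18 * C * MU ^ (1 / 2 : ℝ) * ∫⁻ s, (AU s + GU s + Gu s) ∂μ := by
      rw [hbound]
      dsimp only
      rw [lintegral_add_left' m1', lintegral_const_mul'' _ m1, lintegral_const_mul'' _ m2]
    rw [hsplit]
    exact ENNReal.add_ne_top.2 ⟨ENNReal.mul_ne_top hc1 h1, ENNReal.mul_ne_top hc2 h2⟩
  -- ### the pointwise bounds `F N ≤ E N ≤ bound`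
  have hFE : ∀ N, ∀ᵐ s ∂μ, F N s ≤ E N s := fun N => (ae_restrict_mem measurableSet_Ioo).mono fun s hs => by
    have hsT : s ∈ Ioc 0 T := Ioo_subset_Ioc_self (hsub hs)
    have hus : MemLp (u s) 2 volume := hu.memLp s ⟨hsT.1.le, hsT.2⟩
    have hUs : MemLp (U s) 2 volume := hU.memLp s ⟨hsT.1.le, hsT.2⟩
    exact Torus.enorm_cross_sub_trilinear_truncate_le hus hUs (hu.isWeaklyDivFree_of_mem_Ioc hsT)
      (hU.isWeaklyDivFree_of_mem_Ioc hsT) (hUinv s) N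
  have hEb : ∀ N, ∀ᵐ s ∂μ, E N s ≤ bound s := fun N => by
    filter_upwards [hAule, hAUle, ae_restrict_mem measurableSet_Ioo] with s hsu hsU hsI
    have hsT : s ∈ Ioc 0 T := Ioo_subset_Ioc_self (hsub hsI)
    have hus : MemLp (u s) 2 volume := hu.memLp s ⟨hsT.1.le, hsT.2⟩
    have hUs : MemLp (U s) 2 volume := hU.memLp s ⟨hsT.1.le, hsT.2⟩
    have hδu_le : δu N s ≤ Au s := Torus.lintegral_enorm_sq_fourierTruncate_sub_le_self hus N
    have hδU_le : δU N s ≤ AU s := Torus.lintegral_enorm_sq_fourierTruncate_sub_le_self hUs N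
    have e1 : 18 * C * Au s ^ (1 / 4 : ℝ) * (Au s + Gu s) ^ (1 / 2 : ℝ) * δu N s ^ (1 / 4 : ℝ) * GU s ^ (1 / 2 : ℝ) ≤
        18 * C * Mu ^ (1 / 2 : ℝ) * (Au s + Gu s + GU s) := by
      calc 18 * C * Au s ^ (1 / 4 : ℝ) * (Au s + Gu s) ^ (1 / 2 : ℝ) * δu N s ^ (1 / 4 : ℝ) * GU s ^ (1 / 2 : ℝ)
          = 18 * C * (Au s ^ (1 / 4 : ℝ) * δu N s ^ (1 / 4 : ℝ)) * ((Au s + Gu s) ^ (1 / 2 : ℝ) * GU s ^ (1 / 2 : ℝ)) := by ring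
        _ ≤ 18 * C * (Mu ^ (1 / 4 : ℝ) * Mu ^ (1 / 4 : ℝ)) * (Au s + Gu s + GU s) := by
            refine mul_le_mul' (mul_le_mul' le_rfl (mul_le_mul' ?_ ?_)) (hAMGM _ _)
            · exact ENNReal.rpow_le_rpow hsu (by norm_num)
            · exact ENNReal.rpow_le_rpow (hδu_le.trans hsu) (by norm_num)
        _ = _ := by rw [ENNReal.rpow_quarter_mul_rpow_quarter]
    have e2 : 18 * C * AU s ^ (1 / 4 : ℝ) * (AU s + GU s) ^ (1 / 2 : ℝ) * δU N s ^ (1 / 4 : ℝ) * Gu s ^ (1 / 2 : ℝ) ≤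
        18 * C * MU ^ (1 / 2 : ℝ) * (AU s + GU s + Gu s) := by
      calc 18 * C * AU s ^ (1 / 4 : ℝ) * (AU s + GU s) ^ (1 / 2 : ℝ) * δU N s ^ (1 / 4 : ℝ) * Gu s ^ (1 / 2 : ℝ)
          = 18 * C * (AU s ^ (1 / 4 : ℝ) * δU N s ^ (1 / 4 : ℝ)) * ((AU s + GU s) ^ (1 / 2 : ℝ) * Gu s ^ (1 / 2 : ℝ)) := by ring
        _ ≤ 18 * C * (MU ^ (1 / 4 : ℝ) * MU ^ (1 / 4 : ℝ)) * (AU s + GU s + Gu s) := by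
            refine mul_le_mul' (mul_le_mul' le_rfl (mul_le_mul' ?_ ?_)) (hAMGM _ _)
            · exact ENNReal.rpow_le_rpow hsU (by norm_num)
            · exact ENNReal.rpow_le_rpow (hδU_le.trans hsU) (by norm_num)
        _ = _ := by rw [ENNReal.rpow_quarter_mul_rpow_quarter]
    exact add_le_add e1 e2
  have hFb : ∀ N, ∀ᵐ s ∂μ, F N s ≤ bound s := fun N => by
    filter_upwards [hFE N, hEb N] with s h1 h2
    exact h1.trans h2
  -- ### measurability of the error
  have hFm : ∀ N, AEMeasurable (F N) μ := by
    intro N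
    have hu' := hu.aestronglyMeasurable_uncurry.mono_measure (Measure.prod_mono hle le_rfl)
    have hU' := hU.aestronglyMeasurable_uncurry.mono_measure (Measure.prod_mono hle le_rfl)
    have m1 := Torus.aestronglyMeasurable_integral_inner_convect_fourierTruncate (μ := μ) hu' hu' hU' N
    have m2 := Torus.aestronglyMeasurable_integral_inner_convect_fourierTruncate (μ := μ) hU' hU' hu' N
    have hWm : AEStronglyMeasurable (uncurry fun s x => Torus.fourierTruncate N (u s) x - Torus.fourierTruncate N (U s) x)
        (μ.prod volume) :=
      (Torus.aestronglyMeasurable_uncurry_fourierTruncate hu' N).sub (Torus.aestronglyMeasurable_uncurry_fourierTruncate hU' N)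
    have m3 := Torus.aestronglyMeasurable_integral_inner_convect_fourierTruncate (μ := μ) hWm hWm hU' N
    exact ((m1.add m2).sub m3).enorm
  -- ### pointwise convergence to zero
  have hfin : ∀ᵐ s ∂μ, Gu s < ⊤ ∧ GU s < ⊤ := (ae_lt_top' hmu hlu).and (ae_lt_top' hmU hlU)
  have hlim : ∀ᵐ s ∂μ, Tendsto (fun N => F N s) atTop (𝓝 0) := by
    filter_upwards [hfin, hAule, hAUle, ae_all_iff.2 hFE, ae_restrict_mem measurableSet_Ioo] with s hs hsu hsU hFEs hsI
    have hsT : s ∈ Ioc 0 T := Ioo_subset_Ioc_self (hsub hsI)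
    have hus : MemLp (u s) 2 volume := hu.memLp s ⟨hsT.1.le, hsT.2⟩
    have hUs : MemLp (U s) 2 volume := hU.memLp s ⟨hsT.1.le, hsT.2⟩
    have hAut : Au s ≠ ⊤ := ne_top_of_le_ne_top hMu hsu
    have hAUt : AU s ≠ ⊤ := ne_top_of_le_ne_top hMU hsU
    -- the tails tend to zero, hence their fourth roots
    have hq : ∀ {δ : ℕ → ℝ≥0∞}, Tendsto δ atTop (𝓝 0) → Tendsto (fun N => δ N ^ (1 / 4 : ℝ)) atTop (𝓝 0) := by
      intro δ hδ
      have hc : ContinuousAt (fun a : ℝ≥0∞ => a ^ (1 / 4 : ℝ)) 0 := ENNReal.continuous_rpow_const.continuousAt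
      have := hc.tendsto.comp hδ
      rwa [ENNReal.zero_rpow_of_pos (by norm_num : (0 : ℝ) < 1 / 4)] at this
    have t1 : Tendsto (fun N => δu N s ^ (1 / 4 : ℝ)) atTop (𝓝 0) := hq (Torus.tendsto_lintegral_enorm_sq_fourierTruncate_sub hus)
    have t2 : Tendsto (fun N => δU N s ^ (1 / 4 : ℝ)) atTop (𝓝 0) := hq (Torus.tendsto_lintegral_enorm_sq_fourierTruncate_sub hUs)
    -- finiteness of the constants
    have c1 : 18 * C * Au s ^ (1 / 4 : ℝ) * (Au s + Gu s) ^ (1 / 2 : ℝ) ≠ ⊤ :=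
      ENNReal.mul_ne_top (ENNReal.mul_ne_top (ENNReal.mul_ne_top ENNReal.ofNat_ne_top hCtop)
        (ENNReal.rpow_ne_top_of_nonneg (by norm_num) hAut))
        (ENNReal.rpow_ne_top_of_nonneg (by norm_num) (ENNReal.add_ne_top.2 ⟨hAut, hs.1.ne⟩))
    have c2 : 18 * C * AU s ^ (1 / 4 : ℝ) * (AU s + GU s) ^ (1 / 2 : ℝ) ≠ ⊤ :=
      ENNReal.mul_ne_top (ENNReal.mul_ne_top (ENNReal.mul_ne_top ENNReal.ofNat_ne_top hCtop)
        (ENNReal.rpow_ne_top_of_nonneg (by norm_num) hAUt))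
        (ENNReal.rpow_ne_top_of_nonneg (by norm_num) (ENNReal.add_ne_top.2 ⟨hAUt, hs.2.ne⟩))
    have g1 : GU s ^ (1 / 2 : ℝ) ≠ ⊤ := ENNReal.rpow_ne_top_of_nonneg (by norm_num) hs.2.ne
    have g2 : Gu s ^ (1 / 2 : ℝ) ≠ ⊤ := ENNReal.rpow_ne_top_of_nonneg (by norm_num) hs.1.ne
    have hE0 : Tendsto (fun N => E N s) atTop (𝓝 0) := by
      have e1 : Tendsto (fun N => 18 * C * Au s ^ (1 / 4 : ℝ) * (Au s + Gu s) ^ (1 / 2 : ℝ) * δu N s ^ (1 / 4 : ℝ) *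
          GU s ^ (1 / 2 : ℝ)) atTop (𝓝 0) := by
        have h1 := ENNReal.Tendsto.const_mul (a := 18 * C * Au s ^ (1 / 4 : ℝ) * (Au s + Gu s) ^ (1 / 2 : ℝ)) t1 (Or.inr c1)
        rw [mul_zero] at h1
        have h2 := ENNReal.Tendsto.mul_const (b := GU s ^ (1 / 2 : ℝ)) h1 (Or.inr g1)
        rwa [zero_mul] at h2
      have e2 : Tendsto (fun N => 18 * C * AU s ^ (1 / 4 : ℝ) * (AU s + GU s) ^ (1 / 2 : ℝ) * δU N s ^ (1 / 4 : ℝ) *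
          Gu s ^ (1 / 2 : ℝ)) atTop (𝓝 0) := by
        have h1 := ENNReal.Tendsto.const_mul (a := 18 * C * AU s ^ (1 / 4 : ℝ) * (AU s + GU s) ^ (1 / 2 : ℝ)) t2 (Or.inr c2)
        rw [mul_zero] at h1
        have h2 := ENNReal.Tendsto.mul_const (b := Gu s ^ (1 / 2 : ℝ)) h1 (Or.inr g2)
        rwa [zero_mul] at h2
      have := e1.add e2
      rwa [add_zero] at this
    exact tendsto_of_tendsto_of_tendsto_of_le_of_le tendsto_const_nhds hE0 (fun _ => zero_le) hFEs
  -- ### conclusion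
  refine ⟨hFm, fun N => ne_top_of_le_ne_top hbound_fin (lintegral_mono_ae (hFb N)), ?_⟩
  have h := tendsto_lintegral_of_dominated_convergence' bound hFm hFb hbound_fin hlim
  rwa [lintegral_zero] at h


/-- **The two-dimensional Ladyzhenskaya constant is at least one** (test the defining inequality
with the constant function `1` on the probability space `T²`); dot-notation extension of
`FunctionSpaces/TorusAnisotropicLadyzhenskaya` declared here with its absolute name. [folklore] -/
theorem _root_.Literature.Analysis.FunctionSpaces.Torus.one_le_ladyzhenskayaConst₂ :
    1 ≤ FunctionSpaces.Torus.ladyzhenskayaConst₂ := by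
  have h := FunctionSpaces.Torus.ladyzhenskayaConst₂_spec.2 (fun _ : UnitAddTorus (Fin 2) => (1 : ℝ))
    (Torus.isSmooth_const (1 : ℝ))
  have hd : ∀ i : Fin 2, Torus.partialDeriv i (fun _ : UnitAddTorus (Fin 2) => (1 : ℝ)) = fun _ => 0 := by
    intro i; funext x; simp [Torus.partialDeriv, Torus.lineDeriv]
  simp only [hd, enorm_one, one_pow, lintegral_const, measure_univ, mul_one, enorm_zero,
    ne_eq, OfNat.ofNat_ne_zero, not_false_eq_true, zero_pow, Finset.sum_const_zero,
    add_zero] at h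
  exact h

/-- The anisotropic Ladyzhenskaya constant is non-zero. [folklore] -/
theorem _root_.Literature.Analysis.FunctionSpaces.Torus.anisotropicConst_ne_zero :
    FunctionSpaces.Torus.anisotropicConst ≠ 0 := by
  rw [FunctionSpaces.Torus.anisotropicConst]
  have h1 : (1 : ℝ≥0∞) ≤ FunctionSpaces.Torus.ladyzhenskayaConst₂ ^ (1 / 2 : ℝ) := by
    calc (1 : ℝ≥0∞) = 1 ^ (1 / 2 : ℝ) := by rw [ENNReal.one_rpow]
      _ ≤ _ := ENNReal.rpow_le_rpow FunctionSpaces.Torus.one_le_ladyzhenskayaConst₂ (by norm_num)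
  exact (lt_of_lt_of_le zero_lt_one h1).ne'

/-- **Young's inequality for the Gronwall kernel**, `ℝ≥0∞` form: for `ν ∈ (0,∞)`,
`c a^{1/2} b^{1/2} ≤ ν a + ν⁻¹ c² b` (`x^{1/2}y^{1/2} ≤ x + y` with `x = νa`, `y = ν⁻¹c²b`). [folklore] -/
theorem _root_.ENNReal.mul_rpow_half_mul_rpow_half_le (c a b : ℝ≥0∞) {ν : ℝ≥0∞} (hν : ν ≠ 0) (hν' : ν ≠ ⊤) :
    c * a ^ (1 / 2 : ℝ) * b ^ (1 / 2 : ℝ) ≤ ν * a + ν⁻¹ * c ^ 2 * b := by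
  have key : c * a ^ (1 / 2 : ℝ) * b ^ (1 / 2 : ℝ) = (ν * a) ^ (1 / 2 : ℝ) * (ν⁻¹ * c ^ 2 * b) ^ (1 / 2 : ℝ) := by
    rw [← ENNReal.mul_rpow_of_nonneg _ _ (by norm_num : (0 : ℝ) ≤ 1 / 2),
      show ν * a * (ν⁻¹ * c ^ 2 * b) = (ν * ν⁻¹) * (c ^ 2 * (a * b)) by ring,
      ENNReal.mul_inv_cancel hν hν', one_mul, ENNReal.mul_rpow_of_nonneg _ _ (by norm_num : (0 : ℝ) ≤ 1 / 2),
      ENNReal.mul_rpow_of_nonneg _ _ (by norm_num : (0 : ℝ) ≤ 1 / 2)]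
    have hc : (c ^ 2) ^ (1 / 2 : ℝ) = c := by
      rw [← ENNReal.rpow_natCast, ← ENNReal.rpow_mul]; norm_num
    rw [hc]; ring
  rw [key]
  -- `x^{1/2} y^{1/2} ≤ x + y` (the tree's `ennreal_rpow_half_mul_rpow_half_le` of `NSVelocityUniqueness`,
  -- inlined to keep the import closure small)
  have hAMGM : ∀ x y : ℝ≥0∞, x ^ (1 / 2 : ℝ) * y ^ (1 / 2 : ℝ) ≤ x + y := by
    intro x y
    have hx : x ^ (1 / 2 : ℝ) ≤ (max x y) ^ (1 / 2 : ℝ) := ENNReal.rpow_le_rpow (le_max_left _ _) (by norm_num)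
    have hy : y ^ (1 / 2 : ℝ) ≤ (max x y) ^ (1 / 2 : ℝ) := ENNReal.rpow_le_rpow (le_max_right _ _) (by norm_num)
    calc x ^ (1 / 2 : ℝ) * y ^ (1 / 2 : ℝ) ≤ (max x y) ^ (1 / 2 : ℝ) * (max x y) ^ (1 / 2 : ℝ) := mul_le_mul' hx hy
      _ = max x y := by
          rw [← ENNReal.rpow_add_of_nonneg _ _ (by norm_num) (by norm_num)]; norm_num
      _ ≤ x + y := max_le le_self_add le_add_self
  exact hAMGM _ _

/-- **The difference energy inequality for a three-dimensional perturbation of an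
`x₃`-independent Leray–Hopf solution** (Bardos–Lopes Filho–Niu–Nussenzveig Lopes–Titi 2013,
proof of Thm. 3.1: Serrin's inequality (27), `‖w‖²(T) + 2ν∫₀ᵀ‖∇w‖² ≤ ‖w₀‖² + 2∫₀ᵀ(w·∇w, u)`,
followed by the sliced Ladyzhenskaya bound of the trilinear term). On the flat torus `T³`: let
`u`, `U` be Leray–Hopf weak solutions of the unforced Navier–Stokes equations on `T³ × [0,T)`
with viscosity `ν ≥ 0` and `L²` data `u₀`, `U₀`, and let every slice of `U` be independent of the
third coordinate. Then for every `t ∈ (0, T]`, with `w = u - U`,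
`∫‖w(t)‖² + 2ν∫₀ᵗ‖∇w‖₂² ≤ ∫‖u₀ - U₀‖² + 18C ∫₀ᵗ ‖w‖₂^{1/2}(‖w‖₂²+‖∇w‖₂²)^{1/4}·‖w‖₂^{1/2}(‖w‖₂²+‖∇w‖₂²)^{1/4}·‖∇U‖₂ ds`
in `ℝ≥0∞` (`C = Torus.anisotropicConst`, spectral dissipation `Torus.eGradNormSq`). Proof: the
truncated cross identity (`Torus.IsLerayHopfOn.integral_inner_fourierTruncate_eq_add_setIntegral`)
plus the two energy inequalities at level `N`, the Stokes cross term being exact spectrally; then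
`N → ∞`: the truncated inner products and cross enstrophies converge
(`Torus.tendsto_integral_inner_fourierTruncate_fourierTruncate`,
`Torus.IsLerayHopfOn.tendsto_setIntegral_crossSum`, `Torus.IsLerayHopfOn.toReal_lintegral_eGradNormSq_sub`),
the convective terms equal the trilinear term on the truncations up to an error vanishing in
`L¹(0,t)` (`Torus.IsLerayHopfOn.tendsto_lintegral_cross_sub_trilinear`), and the trilinear term is
bounded by the kernel (`Torus.enorm_integral_inner_convect_truncate_sub_le`). [cite: BardosEtAl2013, Thm. 3.1 (proof)] -/
theorem Torus.IsLerayHopfOn.lintegral_enorm_sub_sq_add_le_of_invariant (hu : Torus.IsLerayHopfOn T ν 0 u₀ u)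
    (hU : Torus.IsLerayHopfOn T ν 0 U₀ U) (hν : 0 ≤ ν) (hT : 0 < T) (hu₀ : MemLp u₀ 2 volume)
    (hU₀ : MemLp U₀ 2 volume)
    (hUinv : ∀ (t : ℝ) (s : UnitAddCircle) (x : UnitAddTorus (Fin 3)), U t (x + Pi.single (2 : Fin 3) s) = U t x)
    {t : ℝ} (ht : t ∈ Ioc 0 T) :
    (∫⁻ x, ‖u t x - U t x‖ₑ ^ 2) + 2 * ENNReal.ofReal ν * ∫⁻ s in Ioo 0 t, Torus.eGradNormSq (u s - U s) ≤
      (∫⁻ x, ‖u₀ x - U₀ x‖ₑ ^ 2) + 2 * (9 * Torus.anisotropicConst) * ∫⁻ s in Ioo 0 t,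
        ((∫⁻ x, ‖u s x - U s x‖ₑ ^ 2) ^ (1 / 4 : ℝ) *
            ((∫⁻ x, ‖u s x - U s x‖ₑ ^ 2) + Torus.eGradNormSq (u s - U s)) ^ (1 / 4 : ℝ)) *
          ((∫⁻ x, ‖u s x - U s x‖ₑ ^ 2) ^ (1 / 4 : ℝ) *
            ((∫⁻ x, ‖u s x - U s x‖ₑ ^ 2) + Torus.eGradNormSq (u s - U s)) ^ (1 / 4 : ℝ)) *
          Torus.eGradNormSq (U s) ^ (1 / 2 : ℝ) := by
  set μ : Measure ℝ := volume.restrict (Ioo 0 t) with hμ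
  have htT : t ≤ T := ht.2
  have hsub : Ioo 0 t ⊆ Ioo 0 T := Ioo_subset_Ioo le_rfl htT
  have hsubc : Ioc 0 t ⊆ Ioc 0 T := Ioc_subset_Ioc_right htT
  set C : ℝ≥0∞ := Torus.anisotropicConst with hC
  -- ### the kernel; the trivial case of an infinite kernel integral
  set K : ℝ → ℝ≥0∞ := fun s => ((∫⁻ x, ‖u s x - U s x‖ₑ ^ 2) ^ (1 / 4 : ℝ) *
      ((∫⁻ x, ‖u s x - U s x‖ₑ ^ 2) + Torus.eGradNormSq (u s - U s)) ^ (1 / 4 : ℝ)) *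
    ((∫⁻ x, ‖u s x - U s x‖ₑ ^ 2) ^ (1 / 4 : ℝ) *
      ((∫⁻ x, ‖u s x - U s x‖ₑ ^ 2) + Torus.eGradNormSq (u s - U s)) ^ (1 / 4 : ℝ)) *
    Torus.eGradNormSq (U s) ^ (1 / 2 : ℝ) with hK
  by_cases hKtop : ∫⁻ s in Ioo 0 t, K s = ⊤
  · rw [hKtop, ENNReal.mul_top (mul_ne_zero two_ne_zero (mul_ne_zero (by norm_num)
      Torus.anisotropicConst_ne_zero)), add_top]
    exact le_top
  -- ### forces and data
  have hf0m : AEStronglyMeasurable (Torus.stLift (0 : ℝ → UnitAddTorus (Fin 3) → EuclideanSpace ℝ (Fin 3)))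
      (volume.restrict (Ioo 0 T ×ˢ univ)) := aestronglyMeasurable_const (b := (0 : EuclideanSpace ℝ (Fin 3)))
  have hf0 : ∫⁻ s in Ioo 0 T, ∫⁻ x : UnitAddTorus (Fin 3),
      ‖(0 : ℝ → UnitAddTorus (Fin 3) → EuclideanSpace ℝ (Fin 3)) s x‖ₑ ^ 2 < ⊤ := by simp
  -- ### slices
  have hut : MemLp (u t) 2 volume := hu.memLp t ⟨ht.1.le, ht.2⟩
  have hUt : MemLp (U t) 2 volume := hU.memLp t ⟨ht.1.le, ht.2⟩
  -- ### real notation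
  set Gu : ℝ := (∫⁻ s in Ioo 0 t, Torus.eGradNormSq (u s)).toReal with hGu
  set GU : ℝ := (∫⁻ s in Ioo 0 t, Torus.eGradNormSq (U s)).toReal with hGU
  set S : ℕ → ℝ := fun N => ∫ x, ⟪Torus.fourierTruncate N (u t) x, Torus.fourierTruncate N (U t) x⟫_ℝ with hS
  set S₀ : ℕ → ℝ := fun N => ∫ x, ⟪Torus.fourierTruncate N u₀ x, Torus.fourierTruncate N U₀ x⟫_ℝ with hS₀
  set D : ℕ → ℝ → ℝ := fun N s => 4 * Real.pi ^ 2 * ∑ k ∈ Torus.freqBall N, Torus.freqNormSq k *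
    (inner ℂ (mFourierCoeff (EuclideanSpace.complexify ∘ u s) k)
      (mFourierCoeff (EuclideanSpace.complexify ∘ U s) k)).re with hD
  set Dl : ℝ → ℝ := fun s => 4 * Real.pi ^ 2 * ∑' k : Fin 3 → ℤ, Torus.freqNormSq k *
    (inner ℂ (mFourierCoeff (EuclideanSpace.complexify ∘ u s) k)
      (mFourierCoeff (EuclideanSpace.complexify ∘ U s) k)).re with hDl
  set X : ℕ → ℝ → ℝ := fun N s => (∫ x, ⟪u s x, Torus.convect (u s) (Torus.fourierTruncate N (U s)) x⟫_ℝ) +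
    ∫ x, ⟪U s x, Torus.convect (U s) (Torus.fourierTruncate N (u s)) x⟫_ℝ with hX
  set Y : ℕ → ℝ → ℝ := fun N s => ∫ x, ⟪Torus.fourierTruncate N (u s) x - Torus.fourierTruncate N (U s) x,
    Torus.convect (fun y => Torus.fourierTruncate N (u s) y - Torus.fourierTruncate N (U s) y)
      (Torus.fourierTruncate N (U s)) x⟫_ℝ with hY
  -- ### the inputs
  obtain ⟨hDint, hDlint, hDlim⟩ := hu.tendsto_setIntegral_crossSum hU htT
  obtain ⟨hGw_fin, hGw⟩ := hu.toReal_lintegral_eGradNormSq_sub hU htT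
  obtain ⟨hFm, hFfin, hFlim⟩ := hu.tendsto_lintegral_cross_sub_trilinear hU hν hUinv htT
  have hSlim : Tendsto S atTop (𝓝 (∫ x, ⟪u t x, U t x⟫_ℝ)) :=
    Torus.tendsto_integral_inner_fourierTruncate_fourierTruncate hut hUt
  have hS₀lim : Tendsto S₀ atTop (𝓝 (∫ x, ⟪u₀ x, U₀ x⟫_ℝ)) :=
    Torus.tendsto_integral_inner_fourierTruncate_fourierTruncate hu₀ hU₀
  have hEu := hu.integral_norm_sq_add_le_of_zero_force (t := t) ⟨ht.1.le, ht.2⟩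
  have hEU := hU.integral_norm_sq_add_le_of_zero_force (t := t) ⟨ht.1.le, ht.2⟩
  -- ### the cross identity at level `N`, rewritten
  have hcross : ∀ N, IntegrableOn (X N) (Ioo 0 t) ∧
      S N = S₀ N + (∫ s in Ioo 0 t, X N s) - 2 * ν * ∫ s in Ioo 0 t, D N s := by
    intro N
    obtain ⟨hInt, hId⟩ := hu.integral_inner_fourierTruncate_eq_add_setIntegral hU hT hf0m hf0 hf0m hf0 hu₀ hU₀ N ht
    -- the integrand on `(0, t]`
    have hptw : ∀ s ∈ Ioo 0 t,
        (∫ x, (⟪u s x, Torus.convect (u s) (Torus.fourierTruncate N (U s)) x⟫_ℝ +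
          ν * ⟪u s x, Torus.laplacian (Torus.fourierTruncate N (U s)) x⟫_ℝ +
          ⟪(0 : ℝ → UnitAddTorus (Fin 3) → EuclideanSpace ℝ (Fin 3)) s x, Torus.fourierTruncate N (U s) x⟫_ℝ)) +
        ∫ x, (⟪U s x, Torus.convect (U s) (Torus.fourierTruncate N (u s)) x⟫_ℝ +
          ν * ⟪U s x, Torus.laplacian (Torus.fourierTruncate N (u s)) x⟫_ℝ +
          ⟪(0 : ℝ → UnitAddTorus (Fin 3) → EuclideanSpace ℝ (Fin 3)) s x, Torus.fourierTruncate N (u s) x⟫_ℝ) =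
        X N s - 2 * ν * D N s := by
      intro s hs
      have hsT : s ∈ Ioc 0 T := Ioo_subset_Ioc_self (hsub hs)
      have hus : MemLp (u s) 2 volume := hu.memLp s ⟨hsT.1.le, hsT.2⟩
      have hUs : MemLp (U s) 2 volume := hU.memLp s ⟨hsT.1.le, hsT.2⟩
      simp only [Pi.zero_apply, inner_zero_left, add_zero]
      rw [Torus.flux_zero_fourierTruncate_eq ν hus N, Torus.flux_zero_fourierTruncate_eq ν hUs N]
      have hsymm : ∑ k ∈ Torus.freqBall N, Torus.freqNormSq k *
          (inner ℂ (mFourierCoeff (EuclideanSpace.complexify ∘ U s) k) (mFourierCoeff (EuclideanSpace.complexify ∘ u s) k)).re =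
          ∑ k ∈ Torus.freqBall N, Torus.freqNormSq k *
          (inner ℂ (mFourierCoeff (EuclideanSpace.complexify ∘ u s) k) (mFourierCoeff (EuclideanSpace.complexify ∘ U s) k)).re := by
        refine Finset.sum_congr rfl fun k _ => ?_
        rw [← inner_conj_symm, Complex.conj_re]
      rw [hsymm, hX, hD]
      ring
    have hae : ∀ᵐ s ∂μ,
        (∫ x, (⟪u s x, Torus.convect (u s) (Torus.fourierTruncate N (U s)) x⟫_ℝ +
          ν * ⟪u s x, Torus.laplacian (Torus.fourierTruncate N (U s)) x⟫_ℝ +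
          ⟪(0 : ℝ → UnitAddTorus (Fin 3) → EuclideanSpace ℝ (Fin 3)) s x, Torus.fourierTruncate N (U s) x⟫_ℝ)) +
        ∫ x, (⟪U s x, Torus.convect (U s) (Torus.fourierTruncate N (u s)) x⟫_ℝ +
          ν * ⟪U s x, Torus.laplacian (Torus.fourierTruncate N (u s)) x⟫_ℝ +
          ⟪(0 : ℝ → UnitAddTorus (Fin 3) → EuclideanSpace ℝ (Fin 3)) s x, Torus.fourierTruncate N (u s) x⟫_ℝ) =
        X N s - 2 * ν * D N s :=
      (ae_restrict_mem measurableSet_Ioo).mono hptw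
    have hInt' : IntegrableOn (fun s => X N s - 2 * ν * D N s) (Ioo 0 t) :=
      ((integrableOn_Ioc_iff_integrableOn_Ioo).1 hInt).congr hae
    have hDN : IntegrableOn (fun s => 2 * ν * D N s) (Ioo 0 t) := (hDint N).const_mul _
    have hXint : IntegrableOn (X N) (Ioo 0 t) := (hInt'.add hDN).congr (ae_of_all _ fun s => by simp)
    refine ⟨hXint, ?_⟩
    rw [hS, hS₀]
    dsimp only
    rw [hId, integral_Ioc_eq_integral_Ioo, integral_congr_ae hae, integral_sub hXint hDN, integral_const_mul]
    ring
  -- ### the trilinear term is bounded by the kernel, the error is small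
  have hXbound : ∀ N, -(∫ s in Ioo 0 t, X N s) ≤
      (∫⁻ s in Ioo 0 t, ‖X N s - Y N s‖ₑ).toReal + (9 * C * ∫⁻ s in Ioo 0 t, K s).toReal := by
    intro N
    obtain ⟨hXint, -⟩ := hcross N
    have hYK : ∀ s ∈ Ioo 0 t, ‖Y N s‖ₑ ≤ 9 * C * K s := by
      intro s hs
      have hsT : s ∈ Ioc 0 T := Ioo_subset_Ioc_self (hsub hs)
      refine (Torus.enorm_integral_inner_convect_truncate_sub_le (hu.memLp s ⟨hsT.1.le, hsT.2⟩)
        (hU.memLp s ⟨hsT.1.le, hsT.2⟩) (hUinv s) N).trans (le_of_eq ?_)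
      rw [hK, hC]
      ring
    have h1 : -(∫ s in Ioo 0 t, X N s) ≤ (∫⁻ s in Ioo 0 t, ‖X N s‖ₑ).toReal := by
      have h := norm_integral_le_lintegral_norm (μ := μ) (X N)
      simp_rw [ofReal_norm] at h
      rw [Real.norm_eq_abs] at h
      exact (neg_le_abs _).trans h
    have h2 : ∫⁻ s in Ioo 0 t, ‖X N s‖ₑ ≤ (∫⁻ s in Ioo 0 t, ‖X N s - Y N s‖ₑ) + 9 * C * ∫⁻ s in Ioo 0 t, K s := by
      calc ∫⁻ s in Ioo 0 t, ‖X N s‖ₑ ≤ ∫⁻ s in Ioo 0 t, (‖X N s - Y N s‖ₑ + ‖Y N s‖ₑ) :=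
            lintegral_mono fun s => by
              calc ‖X N s‖ₑ = ‖(X N s - Y N s) + Y N s‖ₑ := by rw [sub_add_cancel]
                _ ≤ _ := enorm_add_le _ _
        _ = (∫⁻ s in Ioo 0 t, ‖X N s - Y N s‖ₑ) + ∫⁻ s in Ioo 0 t, ‖Y N s‖ₑ := lintegral_add_left' (hFm N) _
        _ ≤ (∫⁻ s in Ioo 0 t, ‖X N s - Y N s‖ₑ) + ∫⁻ s in Ioo 0 t, 9 * C * K s :=
            add_le_add le_rfl (setLIntegral_mono' measurableSet_Ioo hYK)
        _ = _ := by rw [lintegral_const_mul' _ _ (ENNReal.mul_ne_top (by norm_num) Torus.anisotropicConst_ne_top)]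
    have hfin : (∫⁻ s in Ioo 0 t, ‖X N s - Y N s‖ₑ) + 9 * C * ∫⁻ s in Ioo 0 t, K s ≠ ⊤ :=
      ENNReal.add_ne_top.2 ⟨hFfin N, ENNReal.mul_ne_top (ENNReal.mul_ne_top (by norm_num) Torus.anisotropicConst_ne_top) hKtop⟩
    calc -(∫ s in Ioo 0 t, X N s) ≤ (∫⁻ s in Ioo 0 t, ‖X N s‖ₑ).toReal := h1
      _ ≤ ((∫⁻ s in Ioo 0 t, ‖X N s - Y N s‖ₑ) + 9 * C * ∫⁻ s in Ioo 0 t, K s).toReal := ENNReal.toReal_mono hfin h2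
      _ = _ := ENNReal.toReal_add (hFfin N) (ENNReal.mul_ne_top (ENNReal.mul_ne_top (by norm_num) Torus.anisotropicConst_ne_top) hKtop)
  -- ### the inequality at level `N`
  have hN : ∀ N, (∫ x, ‖u t x‖ ^ 2) + (∫ x, ‖U t x‖ ^ 2) - 2 * S N + 2 * ν * (Gu + GU - 2 * ∫ s in Ioo 0 t, D N s) ≤
      (∫ x, ‖u₀ x‖ ^ 2) + (∫ x, ‖U₀ x‖ ^ 2) - 2 * S₀ N +
        2 * (∫⁻ s in Ioo 0 t, ‖X N s - Y N s‖ₑ).toReal + 2 * (9 * C * ∫⁻ s in Ioo 0 t, K s).toReal := by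
    intro N
    obtain ⟨-, hId⟩ := hcross N
    have hb := hXbound N
    nlinarith [hId, hb, hEu, hEU]
  -- ### the limit `N → ∞`
  have hL : Tendsto (fun N => (∫ x, ‖u t x‖ ^ 2) + (∫ x, ‖U t x‖ ^ 2) - 2 * S N + 2 * ν * (Gu + GU - 2 * ∫ s in Ioo 0 t, D N s))
      atTop (𝓝 ((∫ x, ‖u t x‖ ^ 2) + (∫ x, ‖U t x‖ ^ 2) - 2 * (∫ x, ⟪u t x, U t x⟫_ℝ) +
        2 * ν * (Gu + GU - 2 * ∫ s in Ioo 0 t, Dl s))) :=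
    ((tendsto_const_nhds.sub (hSlim.const_mul 2)).add
      ((tendsto_const_nhds.sub (hDlim.const_mul 2)).const_mul (2 * ν)))
  have hR : Tendsto (fun N => (∫ x, ‖u₀ x‖ ^ 2) + (∫ x, ‖U₀ x‖ ^ 2) - 2 * S₀ N +
        2 * (∫⁻ s in Ioo 0 t, ‖X N s - Y N s‖ₑ).toReal + 2 * (9 * C * ∫⁻ s in Ioo 0 t, K s).toReal)
      atTop (𝓝 ((∫ x, ‖u₀ x‖ ^ 2) + (∫ x, ‖U₀ x‖ ^ 2) - 2 * (∫ x, ⟪u₀ x, U₀ x⟫_ℝ) + 2 * 0 +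
        2 * (9 * C * ∫⁻ s in Ioo 0 t, K s).toReal)) := by
    have h0 : Tendsto (fun N => (∫⁻ s in Ioo 0 t, ‖X N s - Y N s‖ₑ).toReal) atTop (𝓝 0) := by
      have h := (ENNReal.tendsto_toReal ENNReal.zero_ne_top).comp hFlim
      rwa [ENNReal.toReal_zero] at h
    exact ((tendsto_const_nhds.sub (hS₀lim.const_mul 2)).add (h0.const_mul 2)).add tendsto_const_nhds
  have hlimit := le_of_tendsto_of_tendsto' hL hR hN
  rw [mul_zero, add_zero] at hlimit
  -- ### identification of the limit
  rw [← Torus.integral_norm_sub_sq_eq hut hUt, ← Torus.integral_norm_sub_sq_eq hu₀ hU₀, ← hGw] at hlimit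
  -- ### back to `ℝ≥0∞`
  have hwt : MemLp (fun x => u t x - U t x) 2 volume := hut.sub hUt
  have hw0 : MemLp (fun x => u₀ x - U₀ x) 2 volume := hu₀.sub hU₀
  have hKfin : 9 * C * ∫⁻ s in Ioo 0 t, K s ≠ ⊤ :=
    ENNReal.mul_ne_top (ENNReal.mul_ne_top (by norm_num) Torus.anisotropicConst_ne_top) hKtop
  have h1 : (∫⁻ x, ‖u t x - U t x‖ₑ ^ 2) + 2 * ENNReal.ofReal ν * ∫⁻ s in Ioo 0 t, Torus.eGradNormSq (u s - U s) =
      ENNReal.ofReal ((∫ x, ‖u t x - U t x‖ ^ 2) + 2 * ν * (∫⁻ s in Ioo 0 t, Torus.eGradNormSq (u s - U s)).toReal) := by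
    rw [ENNReal.ofReal_add (integral_nonneg fun x => sq_nonneg _) (by positivity), ← Torus.lintegral_enorm_sq_eq_ofReal hwt,
      ENNReal.ofReal_mul (by positivity), ENNReal.ofReal_toReal hGw_fin, ENNReal.ofReal_mul (by norm_num),
      ENNReal.ofReal_ofNat]
  have h2 : ENNReal.ofReal ((∫ x, ‖u₀ x - U₀ x‖ ^ 2) + 2 * (9 * C * ∫⁻ s in Ioo 0 t, K s).toReal) ≤
      (∫⁻ x, ‖u₀ x - U₀ x‖ₑ ^ 2) + 2 * (9 * C) * ∫⁻ s in Ioo 0 t, K s := by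
    rw [ENNReal.ofReal_add (integral_nonneg fun x => sq_nonneg _) (by positivity), ← Torus.lintegral_enorm_sq_eq_ofReal hw0,
      ENNReal.ofReal_mul (by norm_num), ENNReal.ofReal_ofNat, ENNReal.ofReal_toReal hKfin]
    exact le_of_eq (by ring)
  rw [h1]
  exact (ENNReal.ofReal_le_ofReal hlimit).trans h2

/-! ### Weak–strong uniqueness and uniqueness for `x₃`-invariant data -/

/-- **Weak–strong uniqueness relative to an `x₃`-independent Leray–Hopf solution**
(Bardos–Lopes Filho–Niu–Nussenzveig Lopes–Titi 2013, Thm. 3.1 with `v₀ = u₀`, and Remark 3.1: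
"An immediate corollary of Theorem 3.1 is the uniqueness of Leray-Hopf weak solutions for
two-dimensional initial data"; the torus form of the printed `D × (0, L)` statement). On `T³`:
if `U` is a Leray–Hopf weak solution of the unforced Navier–Stokes equations on `[0,T)` with
viscosity `ν > 0` and datum `u₀ ∈ L²` all of whose slices are independent of the third
coordinate, then every Leray–Hopf weak solution `u` with the same viscosity and datum agrees with
`U` almost everywhere on every time slice `t ∈ (0, T]`. Proof: the difference inequality
`Torus.IsLerayHopfOn.lintegral_enorm_sub_sq_add_le_of_invariant`, Young's inequality to absorb
the dissipation, and the integral Grönwall lemma with the `L¹` kernel `ν + 324C²ν⁻¹‖∇U(s)‖₂²`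
(`FluidPDE.lintegral_gronwall_eq_zero`). No Prodi–Serrin hypothesis is imposed on `U`. [cite: BardosEtAl2013, Thm. 3.1 and Rem. 3.1] -/
theorem Torus.IsLerayHopfOn.ae_eq_of_invariant (hu : Torus.IsLerayHopfOn T ν 0 u₀ u)
    (hU : Torus.IsLerayHopfOn T ν 0 u₀ U) (hν : 0 < ν) (hT : 0 < T) (hu₀ : MemLp u₀ 2 volume)
    (hUinv : ∀ (t : ℝ) (s : UnitAddCircle) (x : UnitAddTorus (Fin 3)), U t (x + Pi.single (2 : Fin 3) s) = U t x) :
    ∀ t ∈ Ioc 0 T, u t =ᵐ[volume] U t := by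
  -- ### notation
  set y : ℝ → ℝ≥0∞ := fun s => ∫⁻ x, ‖u s x - U s x‖ₑ ^ 2 with hy
  set g : ℝ → ℝ≥0∞ := fun s => Torus.eGradNormSq (u s - U s) with hg
  set e : ℝ → ℝ≥0∞ := fun s => Torus.eGradNormSq (U s) with he
  set νe : ℝ≥0∞ := ENNReal.ofReal ν with hνe
  have hνe0 : νe ≠ 0 := by rw [hνe]; simpa using hν
  have hνetop : νe ≠ ⊤ := ENNReal.ofReal_ne_top
  set C9 : ℝ≥0∞ := 9 * Torus.anisotropicConst with hC9
  have hC9top : C9 ≠ ⊤ := ENNReal.mul_ne_top (by norm_num) Torus.anisotropicConst_ne_top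
  set Kc : ℝ≥0∞ := νe⁻¹ * (2 * C9) ^ 2 with hKc
  have hKctop : Kc ≠ ⊤ := ENNReal.mul_ne_top (ENNReal.inv_ne_top.2 hνe0)
    (ENNReal.pow_ne_top (ENNReal.mul_ne_top ENNReal.ofNat_ne_top hC9top))
  set a : ℝ → ℝ≥0∞ := fun s => νe + Kc * e s with ha
  -- ### forces and measurability
  have hf0m : AEStronglyMeasurable (Torus.stLift (0 : ℝ → UnitAddTorus (Fin 3) → EuclideanSpace ℝ (Fin 3)))
      (volume.restrict (Ioo 0 T ×ˢ univ)) := aestronglyMeasurable_const (b := (0 : EuclideanSpace ℝ (Fin 3)))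
  have hf0 : ∫⁻ s in Ioo 0 T, ∫⁻ x : UnitAddTorus (Fin 3),
      ‖(0 : ℝ → UnitAddTorus (Fin 3) → EuclideanSpace ℝ (Fin 3)) s x‖ₑ ^ 2 < ⊤ := by simp
  have hu' := hu.aestronglyMeasurable_uncurry
  have hU' := hU.aestronglyMeasurable_uncurry
  have hy_meas : AEMeasurable y (volume.restrict (Ioo 0 T)) :=
    ((hu'.sub hU').aemeasurable.enorm.pow_const 2).lintegral_prod_right'
  have he_meas : AEMeasurable e (volume.restrict (Ioo 0 T)) := hU.aemeasurable_eGradNormSq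
  have ha_meas : AEMeasurable a (volume.restrict (Ioo 0 T)) := (he_meas.const_mul Kc).const_add νe
  -- ### uniform `L²` bounds on `[0, T]`
  obtain ⟨Mu, hMu, hMu'⟩ := hu.exists_forall_lintegral_enorm_sq_le hν.le hf0m hf0
  obtain ⟨MU, hMU, hMU'⟩ := hU.exists_forall_lintegral_enorm_sq_le hν.le hf0m hf0
  have hybound : ∀ t ∈ Ioc 0 T, y t ≤ 2 * Mu + 2 * MU := by
    intro t ht
    have ht' : t ∈ Icc 0 T := ⟨ht.1.le, ht.2⟩
    have hmu : AEMeasurable (fun x => ‖u t x‖ₑ ^ 2) volume := (hu.memLp t ht').aestronglyMeasurable.enorm.pow_const _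
    calc y t ≤ ∫⁻ x, (2 * ‖u t x‖ₑ ^ 2 + 2 * ‖U t x‖ₑ ^ 2) := lintegral_mono fun x => enorm_sub_sq_le_two_mul _ _
      _ = 2 * (∫⁻ x, ‖u t x‖ₑ ^ 2) + 2 * ∫⁻ x, ‖U t x‖ₑ ^ 2 := by
          rw [lintegral_add_left' (hmu.const_mul _), lintegral_const_mul' _ _ ENNReal.ofNat_ne_top,
            lintegral_const_mul' _ _ ENNReal.ofNat_ne_top]
      _ ≤ 2 * Mu + 2 * MU := by gcongr <;> [exact hMu' t ht'; exact hMU' t ht']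
  -- ### the kernel `a` is integrable on `(0, T)`
  have haT : ∫⁻ s in Ioo 0 T, a s ≠ ⊤ := by
    have : ∫⁻ s in Ioo 0 T, a s = (∫⁻ _ in Ioo 0 T, νe) + Kc * ∫⁻ s in Ioo 0 T, e s := by
      rw [ha, lintegral_add_left' aemeasurable_const, lintegral_const_mul' _ _ hKctop]
    rw [this, setLIntegral_const]
    exact ENNReal.add_ne_top.2 ⟨ENNReal.mul_ne_top hνetop measure_Ioo_lt_top.ne,
      ENNReal.mul_ne_top hKctop hU.lintegral_eGradNormSq_lt_top.ne⟩
  -- ### the integral inequality `y t ≤ ∫₀ᵗ a y`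
  have hmain : ∀ t ∈ Ioc 0 T, y t ≤ 1 * ∫⁻ s in Ioo 0 t, a s * y s := by
    intro t ht
    rw [one_mul]
    have hsub : Ioo 0 t ⊆ Ioo 0 T := Ioo_subset_Ioo le_rfl ht.2
    set μ : Measure ℝ := volume.restrict (Ioo 0 t) with hμ
    have hle : μ ≤ volume.restrict (Ioo 0 T) := Measure.restrict_mono hsub le_rfl
    have hym : AEMeasurable y μ := hy_meas.mono_measure hle
    have hem : AEMeasurable e μ := he_meas.mono_measure hle
    obtain ⟨hGfin, -⟩ := hu.toReal_lintegral_eGradNormSq_sub hU ht.2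
    set G : ℝ≥0∞ := ∫⁻ s in Ioo 0 t, g s with hG
    have hD := hu.lintegral_enorm_sub_sq_add_le_of_invariant hU hν.le hT hu₀ hu₀ hUinv ht
    have hzero : (∫⁻ x, ‖u₀ x - u₀ x‖ₑ ^ 2) = 0 := by simp
    rw [hzero, zero_add] at hD
    -- pointwise Young
    have hpt : ∀ s, 2 * C9 * ((y s ^ (1 / 4 : ℝ) * (y s + g s) ^ (1 / 4 : ℝ)) * (y s ^ (1 / 4 : ℝ) * (y s + g s) ^ (1 / 4 : ℝ)) *
        e s ^ (1 / 2 : ℝ)) ≤ νe * (y s + g s) + Kc * e s * y s := by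
      intro s
      have h1 : 2 * C9 * ((y s ^ (1 / 4 : ℝ) * (y s + g s) ^ (1 / 4 : ℝ)) * (y s ^ (1 / 4 : ℝ) * (y s + g s) ^ (1 / 4 : ℝ)) *
          e s ^ (1 / 2 : ℝ)) = 2 * C9 * (y s + g s) ^ (1 / 2 : ℝ) * (y s * e s) ^ (1 / 2 : ℝ) := by
        rw [ENNReal.mul_rpow_of_nonneg _ _ (by norm_num : (0 : ℝ) ≤ 1 / 2), ← ENNReal.rpow_quarter_mul_rpow_quarter (y s),
          ← ENNReal.rpow_quarter_mul_rpow_quarter (y s + g s)]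
        ring
      rw [h1]
      calc 2 * C9 * (y s + g s) ^ (1 / 2 : ℝ) * (y s * e s) ^ (1 / 2 : ℝ) ≤ νe * (y s + g s) + νe⁻¹ * (2 * C9) ^ 2 * (y s * e s) :=
            ENNReal.mul_rpow_half_mul_rpow_half_le _ _ _ hνe0 hνetop
        _ = νe * (y s + g s) + Kc * e s * y s := by rw [hKc]; ring
    have hint : 2 * C9 * ∫⁻ s in Ioo 0 t, ((y s ^ (1 / 4 : ℝ) * (y s + g s) ^ (1 / 4 : ℝ)) *
        (y s ^ (1 / 4 : ℝ) * (y s + g s) ^ (1 / 4 : ℝ)) * e s ^ (1 / 2 : ℝ)) ≤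
        νe * (∫⁻ s in Ioo 0 t, y s) + νe * G + ∫⁻ s in Ioo 0 t, Kc * e s * y s := by
      rw [← lintegral_const_mul' _ _ (ENNReal.mul_ne_top ENNReal.ofNat_ne_top hC9top)]
      calc ∫⁻ s in Ioo 0 t, 2 * C9 * ((y s ^ (1 / 4 : ℝ) * (y s + g s) ^ (1 / 4 : ℝ)) *
            (y s ^ (1 / 4 : ℝ) * (y s + g s) ^ (1 / 4 : ℝ)) * e s ^ (1 / 2 : ℝ))
          ≤ ∫⁻ s in Ioo 0 t, (νe * (y s + g s) + Kc * e s * y s) := lintegral_mono fun s => hpt s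
        _ = νe * (∫⁻ s in Ioo 0 t, (y s + g s)) + ∫⁻ s in Ioo 0 t, Kc * e s * y s := by
            have m : AEMeasurable (fun s => Kc * e s * y s) μ := (hem.const_mul Kc).mul hym
            rw [lintegral_add_right' _ m, lintegral_const_mul' _ _ hνetop]
        _ = _ := by rw [lintegral_add_left' hym, mul_add]
    -- absorb the dissipation
    have hGtop : νe * G ≠ ⊤ := ENNReal.mul_ne_top hνetop hGfin
    have e3 : νe * G + (y t + νe * G) ≤ νe * G + ∫⁻ s in Ioo 0 t, a s * y s := by
      have hay : ∫⁻ s in Ioo 0 t, a s * y s = νe * (∫⁻ s in Ioo 0 t, y s) + ∫⁻ s in Ioo 0 t, Kc * e s * y s := by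
        rw [ha]
        dsimp only
        simp_rw [add_mul]
        rw [lintegral_add_left' (hym.const_mul νe), lintegral_const_mul' _ _ hνetop]
      calc νe * G + (y t + νe * G) = y t + 2 * νe * G := by ring
        _ ≤ _ := hD
        _ ≤ _ := hint
        _ = νe * G + ∫⁻ s in Ioo 0 t, a s * y s := by rw [hay]; ring
    have e4 : y t + νe * G ≤ ∫⁻ s in Ioo 0 t, a s * y s := (ENNReal.add_le_add_iff_left hGtop).1 e3
    exact le_self_add.trans e4
  -- ### Grönwall, and conclusion
  intro t ht
  have hM : 2 * Mu + 2 * MU ≠ ⊤ := ENNReal.add_ne_top.2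
    ⟨ENNReal.mul_ne_top ENNReal.ofNat_ne_top hMu, ENNReal.mul_ne_top ENNReal.ofNat_ne_top hMU⟩
  have hy0 : y t = 0 :=
    lintegral_gronwall_eq_zero (φ := y) (a := a) (C := 1) ENNReal.one_ne_top hM hybound haT hmain t ht
  have ht' : t ∈ Icc 0 T := ⟨ht.1.le, ht.2⟩
  have hmw : AEMeasurable (fun x => ‖u t x - U t x‖ₑ ^ 2) volume :=
    ((hu.memLp t ht').sub (hU.memLp t ht')).aestronglyMeasurable.enorm.pow_const _
  have hae : (fun x => ‖u t x - U t x‖ₑ ^ 2) =ᵐ[volume] 0 := (lintegral_eq_zero_iff' hmw).1 hy0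
  filter_upwards [hae] with x hx
  simpa [sub_eq_zero] using hx

/-- **Uniqueness of Leray–Hopf weak solutions for `x₃`-independent data on `T³`**
(Bardos–Lopes Filho–Niu–Nussenzveig Lopes–Titi 2013, Remark 3.1; the input of
Bardos–Titi–Wiedemann 2012, Thm. 5, "this solution is unique within the class of all 3D
Leray-Hopf weak solutions"). For `ν > 0`, `T > 0` and a weakly divergence-free datum
`u₀ ∈ L²(T³)` invariant under all translations along the third axis, any two Leray–Hopf weak
solutions of the unforced Navier–Stokes equations on `T³ × [0,T)` with datum `u₀` agree almost
everywhere on every time slice `t ∈ (0, T]`. Proof: Hopf's theorem in the invariant class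
(`hopf_existence_torus_invariant_holds`, proved in the tree) supplies an `x₃`-independent
Leray–Hopf solution, with which both agree by `Torus.IsLerayHopfOn.ae_eq_of_invariant`. [cite: BardosEtAl2013, Rem. 3.1] -/
theorem Torus.lerayHopf_ae_eq_of_invariant_datum {v : ℝ → UnitAddTorus (Fin 3) → EuclideanSpace ℝ (Fin 3)}
    (hν : 0 < ν) (hT : 0 < T) (hu₀ : MemLp u₀ 2 volume) (hdiv : Torus.IsWeaklyDivFree u₀)
    (hinv₀ : ∀ (s : UnitAddCircle) (x : UnitAddTorus (Fin 3)), u₀ (x + Pi.single (2 : Fin 3) s) = u₀ x)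
    (hu : Torus.IsLerayHopfOn T ν 0 u₀ u) (hv : Torus.IsLerayHopfOn T ν 0 u₀ v) :
    ∀ t ∈ Ioc 0 T, u t =ᵐ[volume] v t := by
  have hf : AEStronglyMeasurable (Torus.stLift (0 : ℝ → UnitAddTorus (Fin 3) → EuclideanSpace ℝ (Fin 3)))
      (volume.restrict (Ioi 0 ×ˢ univ)) := aestronglyMeasurable_const (b := (0 : EuclideanSpace ℝ (Fin 3)))
  have hf₂ : ∀ T', 0 < T' → ∫⁻ s in Ioo 0 T', ∫⁻ x : UnitAddTorus (Fin 3),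
      ‖(0 : ℝ → UnitAddTorus (Fin 3) → EuclideanSpace ℝ (Fin 3)) s x‖ₑ ^ 2 < ⊤ := fun T' _ => by simp
  obtain ⟨U, hUg, hUinv⟩ := hopf_existence_torus_invariant_holds ν hν u₀ hu₀ hdiv hinv₀ 0 hf hf₂
    (fun _ _ _ => rfl)
  have hU : Torus.IsLerayHopfOn T ν 0 u₀ U := hUg T hT
  intro t ht
  exact (hu.ae_eq_of_invariant hU hν hT hu₀ hUinv t ht).trans (hv.ae_eq_of_invariant hU hν hT hu₀ hUinv t ht).symm

end Limit

end Literature.Analysis.FluidPDE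

end
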